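import Literature.Analysis.FluidPDE.Tao2016AveragedNS.NegativeKickSharp
import Literature.Analysis.FluidPDE.Tao2016AveragedNS.CascadeDefect
import Literature.Analysis.FluidPDE.Tao2016AveragedNS.CascadeBounds
import HarnessLib

/-!
# Seed-scale ignition: a budget below `ε²e^{-M}/(8√M)` cannot keep the trigger small (Tao 2016, §5.5)

HONEST FRAMING (cell `pub-fluidc`): low prior, high value-of-information experiment on Tao's
machine paradigm; NOT a claim that NS blows up.

NegativeKick(Sharp).lean showed that an energy-one datum `2ε²e^{-M}/√M`-close to (5.6) — a NEGATIVE
pre-load of the trigger equal to the discounted seed — keeps the trigger of the EXACT flow in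
`[-3ε²e^{-M}, 0]` for the whole cycle, so the rotor `ε⁻²·c·(a,d)` is never driven and the gate does
not fire. This file is the matching POSITIVE statement at the same scale, for APPROXIMATE
trajectories (differentiable `Y` with velocity `V`, sup-defect `‖V - F(Y)‖ ≤ δ` and `‖Y‖ ≤ 2` on
`[0,T)`, the setting of CascadeDefect.lean): if the TOTAL budget `δ₀ + δT` (datum + forcing over the
window) is at most `ε²e^{-M}/(8√M)`, then the trigger exceeds the IGNITION MAGNITUDE `|c| = ε²`
(the level at which the rotor turns at unit rate) at some time in `[0, 8/5]` (`ignition_forced`).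
Thus the minimal budget that keeps `|c| ≤ ε²` over a cycle lies between `ε²e^{-M}/(8√M)` and
`2ε²e^{-M}/√M` (`stall_threshold_two_sided`): the stall threshold of the gate IS the discounted seed
`Θ(ε²e^{-M}/√M)`, for data and forcings alike.

Mechanism: the discounted trigger `D = c·e^{-G}`, `G = ∫₀ᵗ ε⁻¹Mb`, obeys `D' = (ε²e^{-M}a² + θ_c)e^{-G}`
with `|θ_c| ≤ δ`; on the Gaussian window `[0, 1/√M]` the clock satisfies `G ≤ 51/100`, so the seed
deposits at least `(9/20)ε²e^{-M}/√M` of discounted pre-load, of which the budget can remove at most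
`δ₀ + 2δ ≤ ε²e^{-M}/(8√M)`; if `|c|` stayed `≤ ε²` on `[0, 8/5]` the clock would keep running
(`G ≥ -1/100` throughout, `b ≥ (49/50)ε` on `[1, 8/5]`, `G(8/5) ≥ (1083/1000)M - 1/320`), so
`D ≥ (13/40)ε²e^{-M}/√M` would persist and be amplified to `c(8/5) = D(8/5)e^{G(8/5)} ≥ 2ε²` — a
contradiction. All a-priori bounds (energy drift
`≤ 20δt`, `b ≤ δ₀ + (ε(1+16η)+δ)t`, `|c| ≤ 3ε²e^{-M/2}` and `|d|, |ã| ≤ 7e^{-M/2}` on `[0,1]`,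
`a² ≥ 1 - 1/1000`, two-sided clock bounds) are proved for approximate trajectories and exported for
the transition-phase analysis that a positive seed-scale shadowing theorem still requires (NOT done
here: this file does not prove that the gate FIRES, only that ignition magnitude is reached).

Layout note: the a-priori and persistence lemmas of §3–§4 are proved under the WEAK budget
`δ₀ + 2δ ≤ ε²e^{-M}/8` in `section Eighth` (primed names) and re-exported with unchanged statements
under the seed-scale budget in `section Seed`; only the Gaussian-window deposit (`disc_window`) and the
final contradiction use the `1/√M`.
-/

namespace Literature.Analysis.FluidPDE.Tao2016AveragedNS

open Real Set MeasureTheory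
open scoped NNReal
open NegKick (clockInt clockInt_zero)

namespace Ignition

/-! ## §1. Pointwise facts: coordinates, components of the field, the energy derivative -/

/-- One mode's square is at most the energy. [folklore] -/
theorem sq_le_energy (p : Fin 5 → ℝ) (i : Fin 5) : p i ^ 2 ≤ energy p := by
  unfold energy
  exact Finset.single_le_sum (f := fun j => p j ^ 2) (fun j _ => sq_nonneg (p j))
    (Finset.mem_univ i)

/-- The energy of a state of `ℝ⁵`, expanded. [folklore] -/
theorem energy_five (p : Fin 5 → ℝ) :
    energy p = p 0 ^ 2 + p 1 ^ 2 + p 2 ^ 2 + p 3 ^ 2 + p 4 ^ 2 := by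
  simp [energy, Fin.sum_univ_five]

/-- The clock component of the member's field: `ḃ = εa² - ε⁻¹Mc²`. [cite: Tao2016AveragedNS, §5.5 (5.5)] -/
theorem field_one (K M ε : ℝ) (X : Fin 5 → ℝ) :
    delayCircuitWith K M ε X 1 = ε * X 0 ^ 2 - ε⁻¹ * M * X 2 ^ 2 := by
  simp [delayCircuitWith]

/-- The trigger component of the member's field: `ċ = ε²e^{-M}a² + ε⁻¹Mbc`.
[cite: Tao2016AveragedNS, §5.5 (5.5)] -/
theorem field_two (K M ε : ℝ) (X : Fin 5 → ℝ) :
    delayCircuitWith K M ε X 2 = ε ^ 2 * exp (-M) * X 0 ^ 2 + ε⁻¹ * M * X 1 * X 2 := by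
  simp [delayCircuitWith]

/-- The rotor component: `ḋ = ε⁻²ca - Kdã`. [cite: Tao2016AveragedNS, §5.5 (5.5)] -/
theorem field_three (K M ε : ℝ) (X : Fin 5 → ℝ) :
    delayCircuitWith K M ε X 3 = (ε ^ 2)⁻¹ * X 2 * X 0 - K * X 3 * X 4 := by
  simp [delayCircuitWith]

/-- The output component: `ã' = Kd²`. [cite: Tao2016AveragedNS, §5.5 (5.5)] -/
theorem field_four (K M ε : ℝ) (X : Fin 5 → ℝ) :
    delayCircuitWith K M ε X 4 = K * X 3 ^ 2 := by
  simp [delayCircuitWith]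

/-- **Energy balance of an approximate state**: if `‖V - F(p)‖ ≤ δ` and `‖p‖ ≤ 2` then
`|2·⟨V, p⟩| ≤ 20δ` — the design field cancels (`⟨F(p), p⟩ = 0`), only the defect works.
[cite: Tao2016AveragedNS, §5 (g-cancel)] -/
theorem abs_energy_rate_le {K M ε δ : ℝ} {p W : Fin 5 → ℝ}
    (hW : ‖W - delayCircuitWith K M ε p‖ ≤ δ) (hp : ‖p‖ ≤ 2) :
    |2 * ∑ i, W i * p i| ≤ 20 * δ := by
  have hcancel : ∑ i, delayCircuitWith K M ε p i * p i = 0 :=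
    isCancelling_delayCircuitWith K M ε p
  have hsplit : ∑ i, W i * p i = ∑ i, (W i - delayCircuitWith K M ε p i) * p i := by
    have : ∑ i, W i * p i =
        ∑ i, ((W i - delayCircuitWith K M ε p i) * p i + delayCircuitWith K M ε p i * p i) :=
      Finset.sum_congr rfl fun i _ => by ring
    rw [this, Finset.sum_add_distrib, hcancel, add_zero]
  rw [hsplit]
  have hδ : 0 ≤ δ := (norm_nonneg _).trans hW
  have hterm : ∀ i, |(W i - delayCircuitWith K M ε p i) * p i| ≤ δ * 2 := fun i => by
    rw [abs_mul]
    exact mul_le_mul (abs_coord_defect_le hW i) (abs_apply_le_of_norm_le hp i) (abs_nonneg _) hδ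
  have hsum : |∑ i, (W i - delayCircuitWith K M ε p i) * p i| ≤ ∑ _i : Fin 5, δ * 2 :=
    (Finset.abs_sum_le_sum_abs _ _).trans (Finset.sum_le_sum fun i _ => hterm i)
  simp only [Finset.sum_const, Finset.card_univ, Fintype.card_fin, nsmul_eq_mul] at hsum
  push_cast at hsum
  rw [abs_mul, abs_two]
  linarith

/-- **Energy of a datum `δ₀`-close to (5.6)** (`δ₀ ≤ 1`): `|energy - 1| ≤ 7δ₀`.
[cite: Tao2016AveragedNS, §5.5 (5.6)] -/
theorem abs_energy_init_le {p : Fin 5 → ℝ} {δ₀ : ℝ} (h : ‖p - delayInit‖ ≤ δ₀) (hδ₀ : δ₀ ≤ 1) :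
    |energy p - 1| ≤ 7 * δ₀ := by
  have hw : ∀ i, |p i - delayInit i| ≤ δ₀ := fun i => by
    have := norm_le_pi_norm (p - delayInit) i
    rw [Pi.sub_apply, Real.norm_eq_abs] at this
    exact this.trans h
  have h0 : |p 0 - 1| ≤ δ₀ := by simpa [delayInit] using hw 0
  have h1 : |p 1| ≤ δ₀ := by simpa [delayInit] using hw 1
  have h2 : |p 2| ≤ δ₀ := by simpa [delayInit] using hw 2
  have h3 : |p 3| ≤ δ₀ := by simpa [delayInit] using hw 3
  have h4 : |p 4| ≤ δ₀ := by simpa [delayInit] using hw 4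
  rw [energy_five]
  obtain ⟨h0a, h0b⟩ := abs_le.1 h0
  have hsq : ∀ x : ℝ, |x| ≤ δ₀ → x ^ 2 ≤ δ₀ := fun x hx => by
    have : x ^ 2 ≤ δ₀ ^ 2 := by rw [← sq_abs]; exact pow_le_pow_left₀ (abs_nonneg x) hx 2
    nlinarith
  have e1 := hsq _ h1; have e2 := hsq _ h2; have e3 := hsq _ h3; have e4 := hsq _ h4
  rw [abs_le]
  constructor
  · nlinarith [sq_nonneg (p 1), sq_nonneg (p 2), sq_nonneg (p 3), sq_nonneg (p 4)]
  · nlinarith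

/-- Coordinates of a datum `δ₀`-close to (5.6): `|b|, |c|, |d|, |ã| ≤ δ₀` at time `0`.
[cite: Tao2016AveragedNS, §5.5 (5.6)] -/
theorem abs_init_coord_le {p : Fin 5 → ℝ} {δ₀ : ℝ} (h : ‖p - delayInit‖ ≤ δ₀) :
    |p 1| ≤ δ₀ ∧ |p 2| ≤ δ₀ ∧ |p 3| ≤ δ₀ ∧ |p 4| ≤ δ₀ := by
  have hw : ∀ i, |p i - delayInit i| ≤ δ₀ := fun i => by
    have := norm_le_pi_norm (p - delayInit) i
    rw [Pi.sub_apply, Real.norm_eq_abs] at this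
    exact this.trans h
  exact ⟨by simpa [delayInit] using hw 1, by simpa [delayInit] using hw 2,
    by simpa [delayInit] using hw 3, by simpa [delayInit] using hw 4⟩

/-- `x² + y² + μ² ≤ (|x| + |y| + μ)²` for `μ ≥ 0`. [folklore] -/
theorem sq_add_sq_add_sq_le (x y μ : ℝ) (hμ : 0 ≤ μ) :
    x * x + y * y + μ ^ 2 ≤ (|x| + |y| + μ) ^ 2 := by
  have h1 : x * x = |x| * |x| := (abs_mul_abs_self x).symm
  have h2 : y * y = |y| * |y| := (abs_mul_abs_self y).symm
  have h3 : 0 ≤ |x| := abs_nonneg x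
  have h4 : 0 ≤ |y| := abs_nonneg y
  rw [h1, h2]
  nlinarith [mul_nonneg h3 h4, mul_nonneg h3 hμ, mul_nonneg h4 hμ]

/-! ## §2. A-priori bounds along an approximate trajectory on the window `[0, 8/5]` -/

section Approx

variable {K M ε δ δ₀ T : ℝ} {Y V : ℝ → Fin 5 → ℝ}
  (hY : ∀ t, HasDerivAt Y (V t) t)
  (hV : ∀ t ∈ Ico 0 T, ‖V t - delayCircuitWith K M ε (Y t)‖ ≤ δ)
  (hR : ∀ t ∈ Ico 0 T, ‖Y t‖ ≤ 2) (hT : 2 ≤ T)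
include hY hV hR hT

omit hY hV hR in
/-- The working window `[0, 8/5]` lies inside `[0, T)`. [folklore] -/
theorem mem_Ico_of_mem_window {t : ℝ} (ht : t ∈ Icc (0 : ℝ) (8 / 5)) : t ∈ Ico 0 T :=
  ⟨ht.1, by linarith [ht.2]⟩

omit hY hR in
/-- The defect is non-negative (the window is non-empty). [folklore] -/
theorem defect_nonneg : 0 ≤ δ :=
  (norm_nonneg _).trans (hV 0 ⟨le_rfl, by linarith⟩)

omit hV hR hT in
/-- Modes of an approximate trajectory are continuous. [folklore] -/
theorem continuous_coord (i : Fin 5) : Continuous fun t => Y t i :=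
  (continuous_apply i).comp (continuous_iff_continuousAt.2 fun t => (hY t).continuousAt)

omit hT in
/-- **Energy drift** `|energy(Y t) - energy(Y 0)| ≤ 20δt` on `[0,T)`.
[cite: Tao2016AveragedNS, §5 (g-cancel)] -/
theorem abs_energy_sub_le {t : ℝ} (ht : t ∈ Ico 0 T) :
    |energy (Y t) - energy (Y 0)| ≤ 20 * δ * t := by
  have hd : ∀ u ∈ Ico 0 T, HasDerivAt (fun s => energy (Y s)) (2 * ∑ i, V u i * Y u i) u :=
    fun u _ => hasDerivAt_energy (hY u)
  have hup := Thm53.antitoneOn_sub_of_deriv_le (s := Ico 0 T) (f := fun s => energy (Y s))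
    (φ := fun _ => 20 * δ) (Φ := fun u => 20 * δ * u) (convex_Ico 0 T) hd
    (fun u _ => by simpa using (hasDerivAt_id u).const_mul (20 * δ))
    (fun u hu => (abs_le.1 (abs_energy_rate_le (hV u hu) (hR u hu))).2)
  have hlo := Thm53.monotoneOn_sub_of_le_deriv (s := Ico 0 T) (f := fun s => energy (Y s))
    (φ := fun _ => -(20 * δ)) (Φ := fun u => -(20 * δ) * u) (convex_Ico 0 T) hd
    (fun u _ => by simpa using (hasDerivAt_id u).const_mul (-(20 * δ)))
    (fun u hu => (abs_le.1 (abs_energy_rate_le (hV u hu) (hR u hu))).1)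
  have h0 : (0 : ℝ) ∈ Ico 0 T := ⟨le_rfl, ht.1.trans_lt ht.2⟩
  have h1 := hup h0 ht ht.1
  have h2 := hlo h0 ht ht.1
  simp only [mul_zero, sub_zero] at h1 h2
  rw [abs_le]; constructor <;> linarith

/-- **Energy on the window** for a datum `δ₀`-close to (5.6), `δ₀ ≤ 1`:
`|energy(Y t) - 1| ≤ 7δ₀ + 32δ` on `[0, 8/5]`. [cite: Tao2016AveragedNS, §5.5 (energy-con)] -/
theorem abs_energy_sub_one_le (h0 : ‖Y 0 - delayInit‖ ≤ δ₀) (hδ₀ : δ₀ ≤ 1) {t : ℝ}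
    (ht : t ∈ Icc (0 : ℝ) (8 / 5)) : |energy (Y t) - 1| ≤ 7 * δ₀ + 32 * δ := by
  have h1 := abs_energy_sub_le hY hV hR (mem_Ico_of_mem_window hT ht)
  have h2 := abs_energy_init_le h0 hδ₀
  have hδ := defect_nonneg hV hT
  have h3 : |energy (Y t) - 1| ≤ |energy (Y t) - energy (Y 0)| + |energy (Y 0) - 1| := by
    have := abs_add_le (energy (Y t) - energy (Y 0)) (energy (Y 0) - 1)
    rwa [show energy (Y t) - energy (Y 0) + (energy (Y 0) - 1) = energy (Y t) - 1 by ring] at this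
  nlinarith [ht.2]

/-- Squares of the modes on the window: `Yᵢ² ≤ 1 + 7δ₀ + 32δ`. [cite: Tao2016AveragedNS, §5.5 (energy-con)] -/
theorem sq_coord_le (h0 : ‖Y 0 - delayInit‖ ≤ δ₀) (hδ₀ : δ₀ ≤ 1) {t : ℝ}
    (ht : t ∈ Icc (0 : ℝ) (8 / 5)) (i : Fin 5) : Y t i ^ 2 ≤ 1 + 7 * δ₀ + 32 * δ := by
  have h1 := (abs_le.1 (abs_energy_sub_one_le hY hV hR hT h0 hδ₀ ht)).2
  have h2 := sq_le_energy (Y t) i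
  linarith

/-- **Clock upper bound**: `b(t) ≤ δ₀ + (ε(1 + 7δ₀ + 32δ) + δ)t` on the window (`ḃ ≤ εa² + δ`).
[cite: Tao2016AveragedNS, §5.5 (5.5) b-equation] -/
theorem b_le (h0 : ‖Y 0 - delayInit‖ ≤ δ₀) (hδ₀ : δ₀ ≤ 1) (hε : 0 < ε) (hM : 0 ≤ M) {t : ℝ}
    (ht : t ∈ Icc (0 : ℝ) (8 / 5)) :
    Y t 1 ≤ δ₀ + (ε * (1 + 7 * δ₀ + 32 * δ) + δ) * t := by
  set k : ℝ := ε * (1 + 7 * δ₀ + 32 * δ) + δ with hk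
  have hanti := Thm53.antitoneOn_sub_of_deriv_le (s := Icc (0 : ℝ) (8 / 5)) (f := fun s => Y s 1)
    (φ := fun _ => k) (Φ := fun u => k * u) (convex_Icc 0 _)
    (fun u _ => hasDerivAt_coord (hY u) 1)
    (fun u _ => by simpa using (hasDerivAt_id u).const_mul k) (fun u hu => by
      have hθ := abs_coord_defect_le (hV u (mem_Ico_of_mem_window hT hu)) 1
      rw [field_one] at hθ
      have ha := sq_coord_le hY hV hR hT h0 hδ₀ hu 0
      have h1 : ε * Y u 0 ^ 2 ≤ ε * (1 + 7 * δ₀ + 32 * δ) := mul_le_mul_of_nonneg_left ha hε.le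
      have h2 : 0 ≤ ε⁻¹ * M * Y u 2 ^ 2 := by positivity
      rw [hk]; linarith [(abs_le.1 hθ).2])
  have h := hanti (left_mem_Icc.2 (by norm_num)) ht ht.1
  have hb0 := (abs_le.1 (abs_init_coord_le h0).1).2
  simp only [mul_zero, sub_zero] at h
  linarith

omit hV hR hT in
/-- `G' = ε⁻¹M·b` along an approximate trajectory (the clock integral of NegativeKick.lean).
[folklore] -/
theorem hasDerivAt_clockIntA (t : ℝ) : HasDerivAt (clockInt ε M Y) (ε⁻¹ * M * Y t 1) t := by
  have hc : Continuous fun r => ε⁻¹ * M * Y r 1 :=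
    continuous_const.mul (continuous_coord hY 1)
  show HasDerivAt (fun u => ∫ r in (0 : ℝ)..u, ε⁻¹ * M * Y r 1) (ε⁻¹ * M * Y t 1) t
  exact (hc.integral_hasStrictDerivAt 0 t).hasDerivAt

/-- The majorant clock `G⁺(t) = ε⁻¹M(δ₀t + (ε(1+7δ₀+32δ)+δ)t²/2)`. [folklore] -/
noncomputable def clockSup (M ε δ δ₀ t : ℝ) : ℝ :=
  ε⁻¹ * M * (δ₀ * t + (ε * (1 + 7 * δ₀ + 32 * δ) + δ) * t ^ 2 / 2)

omit hY hV hR hT in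
/-- `(G⁺)' = ε⁻¹M(δ₀ + (ε(1+7δ₀+32δ)+δ)t)`. [folklore] -/
theorem hasDerivAt_clockSup (M ε δ δ₀ t : ℝ) :
    HasDerivAt (clockSup M ε δ δ₀) (ε⁻¹ * M * (δ₀ + (ε * (1 + 7 * δ₀ + 32 * δ) + δ) * t)) t := by
  unfold clockSup
  have h := (((hasDerivAt_id' t).const_mul δ₀).add
    (((hasDerivAt_pow 2 t).const_mul (ε * (1 + 7 * δ₀ + 32 * δ) + δ)).div_const 2)).const_mul
    (ε⁻¹ * M)
  refine h.congr_deriv ?_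
  have e : ((2 : ℕ) : ℝ) * t ^ (2 - 1) = 2 * t := by norm_num
  rw [e]; ring

omit hY hV hR hT in
/-- `G⁺(0) = 0`. [folklore] -/
theorem clockSup_zero (M ε δ δ₀ : ℝ) : clockSup M ε δ δ₀ 0 = 0 := by simp [clockSup]

omit hY hV hR hT in
/-- `G⁺` is non-negative and non-decreasing on `t ≥ 0` (non-negative data). [folklore] -/
theorem clockSup_mono (hM : 0 ≤ M) (hε : 0 < ε) (hδ : 0 ≤ δ) (hδ₀ : 0 ≤ δ₀) {r t : ℝ}
    (hr : 0 ≤ r) (hrt : r ≤ t) : clockSup M ε δ δ₀ r ≤ clockSup M ε δ δ₀ t := by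
  unfold clockSup
  have hk : 0 ≤ ε * (1 + 7 * δ₀ + 32 * δ) + δ := by positivity
  have h1 : δ₀ * r + (ε * (1 + 7 * δ₀ + 32 * δ) + δ) * r ^ 2 / 2 ≤
      δ₀ * t + (ε * (1 + 7 * δ₀ + 32 * δ) + δ) * t ^ 2 / 2 := by
    have : r ^ 2 ≤ t ^ 2 := pow_le_pow_left₀ hr hrt 2
    nlinarith
  exact mul_le_mul_of_nonneg_left h1 (by positivity)

/-- **The clock runs at most like `G⁺`**: `t ↦ G(t) - G⁺(t)` is non-increasing on the window.
[cite: Tao2016AveragedNS, §5.5 (5.5) b-equation] -/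
theorem clockGap_antitoneOnA (h0 : ‖Y 0 - delayInit‖ ≤ δ₀) (hδ₀ : δ₀ ≤ 1) (hε : 0 < ε)
    (hM : 0 ≤ M) :
    AntitoneOn (fun t => clockInt ε M Y t - clockSup M ε δ δ₀ t) (Icc (0 : ℝ) (8 / 5)) :=
  Thm53.antitoneOn_sub_of_deriv_le (convex_Icc 0 _)
    (fun t _ => hasDerivAt_clockIntA hY t) (fun t _ => hasDerivAt_clockSup M ε δ δ₀ t)
    fun t ht => mul_le_mul_of_nonneg_left (b_le hY hV hR hT h0 hδ₀ hε hM ht) (by positivity)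

/-- `G(t) - G(r) ≤ G⁺(t) - G⁺(r)` for `0 ≤ r ≤ t ≤ 8/5`; in particular `G(t) ≤ G⁺(t)`.
[cite: Tao2016AveragedNS, §5.5] -/
theorem clockInt_sub_leA (h0 : ‖Y 0 - delayInit‖ ≤ δ₀) (hδ₀ : δ₀ ≤ 1) (hε : 0 < ε) (hM : 0 ≤ M)
    {r t : ℝ} (hr : 0 ≤ r) (hrt : r ≤ t) (ht : t ≤ 8 / 5) :
    clockInt ε M Y t - clockInt ε M Y r ≤ clockSup M ε δ δ₀ t - clockSup M ε δ δ₀ r := by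
  have h := clockGap_antitoneOnA hY hV hR hT h0 hδ₀ hε hM ⟨hr, hrt.trans ht⟩ ⟨hr.trans hrt, ht⟩ hrt
  simp only at h
  linarith

/-- `G(t) ≤ G⁺(t)` on the window. [cite: Tao2016AveragedNS, §5.5] -/
theorem clockInt_le_clockSup (h0 : ‖Y 0 - delayInit‖ ≤ δ₀) (hδ₀ : δ₀ ≤ 1) (hε : 0 < ε)
    (hM : 0 ≤ M) {t : ℝ} (ht : t ∈ Icc (0 : ℝ) (8 / 5)) :
    clockInt ε M Y t ≤ clockSup M ε δ δ₀ t := by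
  have := clockInt_sub_leA hY hV hR hT h0 hδ₀ hε hM le_rfl ht.1 ht.2
  simpa [clockInt_zero, clockSup_zero] using this

omit hV hR hT in
/-- **The discounted trigger of an approximate trajectory**:
`(c·e^{-G})' = (V₂ - ε⁻¹Mbc)·e^{-G} = (ε²e^{-M}a² + θ_c)·e^{-G}`, `|θ_c| ≤ δ`.
[cite: Tao2016AveragedNS, §5.5 proof of Theorem 5.3] -/
theorem hasDerivAt_discA (t : ℝ) :
    HasDerivAt (fun s => Y s 2 * exp (-clockInt ε M Y s))
      ((V t 2 - ε⁻¹ * M * Y t 1 * Y t 2) * exp (-clockInt ε M Y t)) t := by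
  refine ((hasDerivAt_coord (hY t) 2).fun_mul
    (hasDerivAt_clockIntA hY t).fun_neg.exp).congr_deriv ?_
  ring

omit hY hV hR hT in
/-- The drive of the discounted trigger, split into seed and defect:
`V₂ - ε⁻¹Mbc = ε²e^{-M}a² + (V₂ - F₂(Y))`. [cite: Tao2016AveragedNS, §5.5 (5.5)] -/
theorem disc_drive_eq (t : ℝ) :
    V t 2 - ε⁻¹ * M * Y t 1 * Y t 2 =
      ε ^ 2 * exp (-M) * Y t 0 ^ 2 + (V t 2 - delayCircuitWith K M ε (Y t) 2) := by
  rw [field_two]; ring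

/-- Upper bound of the discounted drive on the window: `≤ (ε²e^{-M}(1+7δ₀+32δ) + δ)·e^{-G}`.
[cite: Tao2016AveragedNS, §5.5] -/
theorem disc_deriv_leA (h0 : ‖Y 0 - delayInit‖ ≤ δ₀) (hδ₀ : δ₀ ≤ 1) {t : ℝ}
    (ht : t ∈ Icc (0 : ℝ) (8 / 5)) :
    (V t 2 - ε⁻¹ * M * Y t 1 * Y t 2) * exp (-clockInt ε M Y t) ≤
      (ε ^ 2 * exp (-M) * (1 + 7 * δ₀ + 32 * δ) + δ) * exp (-clockInt ε M Y t) := by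
  refine mul_le_mul_of_nonneg_right ?_ (exp_pos _).le
  rw [disc_drive_eq (K := K)]
  have hθ := (abs_le.1 (abs_coord_defect_le (hV t (mem_Ico_of_mem_window hT ht)) 2)).2
  have ha := sq_coord_le hY hV hR hT h0 hδ₀ ht 0
  have h1 : ε ^ 2 * exp (-M) * Y t 0 ^ 2 ≤ ε ^ 2 * exp (-M) * (1 + 7 * δ₀ + 32 * δ) :=
    mul_le_mul_of_nonneg_left ha (by positivity)
  linarith

omit hY hR in
/-- Lower bound of the discounted drive: `≥ (ε²e^{-M}a² - δ)·e^{-G} ≥ -δ·e^{-G}`.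
[cite: Tao2016AveragedNS, §5.5] -/
theorem disc_deriv_geA {t : ℝ} (ht : t ∈ Icc (0 : ℝ) (8 / 5)) :
    (ε ^ 2 * exp (-M) * Y t 0 ^ 2 - δ) * exp (-clockInt ε M Y t) ≤
      (V t 2 - ε⁻¹ * M * Y t 1 * Y t 2) * exp (-clockInt ε M Y t) := by
  refine mul_le_mul_of_nonneg_right ?_ (exp_pos _).le
  rw [disc_drive_eq (K := K)]
  have hθ := (abs_le.1 (abs_coord_defect_le (hV t (mem_Ico_of_mem_window hT ht)) 2)).1
  linarith

/-- **A-priori upper bound on the trigger**: `c(t) ≤ (δ₀ + (ε²e^{-M}(1+7δ₀+32δ) + δ)t)·e^{G⁺(t)}`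
on the window (the discounted drive on `[0,t]` is at most `k·e^{-G(u)} ≤ k·e^{-G(t)+G⁺(t)}`).
[cite: Tao2016AveragedNS, §5.5] -/
theorem c_le (h0 : ‖Y 0 - delayInit‖ ≤ δ₀) (hδ₀ : δ₀ ≤ 1) (hε : 0 < ε) (hM : 0 ≤ M) {t : ℝ}
    (ht : t ∈ Icc (0 : ℝ) (8 / 5)) :
    Y t 2 ≤ (δ₀ + (ε ^ 2 * exp (-M) * (1 + 7 * δ₀ + 32 * δ) + δ) * t) *
      exp (clockSup M ε δ δ₀ t) := by
  have hδ := defect_nonneg hV hT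
  have hδ₀0 : 0 ≤ δ₀ := (norm_nonneg _).trans h0
  set m : ℝ := ε ^ 2 * exp (-M) * (1 + 7 * δ₀ + 32 * δ) + δ with hm
  have hm0 : 0 ≤ m := by positivity
  set k : ℝ := m * exp (-clockInt ε M Y t + clockSup M ε δ δ₀ t) with hk
  have hanti := Thm53.antitoneOn_sub_of_deriv_le (s := Icc 0 t)
    (f := fun s => Y s 2 * exp (-clockInt ε M Y s)) (φ := fun _ => k) (Φ := fun u => k * u)
    (convex_Icc 0 t) (fun u _ => hasDerivAt_discA hY u)
    (fun u _ => by simpa using (hasDerivAt_id u).const_mul k) (fun u hu => by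
      have hu' : u ∈ Icc (0 : ℝ) (8 / 5) := ⟨hu.1, hu.2.trans ht.2⟩
      have h1 := disc_deriv_leA hY hV hR hT h0 hδ₀ hu'
      have hG := clockInt_sub_leA hY hV hR hT h0 hδ₀ hε hM hu.1 hu.2 ht.2
      have hGu : 0 ≤ clockSup M ε δ δ₀ u := by
        have := clockSup_mono hM hε hδ hδ₀0 le_rfl hu.1 (M := M)
        rwa [clockSup_zero] at this
      have h2 : exp (-clockInt ε M Y u) ≤ exp (-clockInt ε M Y t + clockSup M ε δ δ₀ t) :=
        exp_le_exp.2 (by linarith)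
      calc (V u 2 - ε⁻¹ * M * Y u 1 * Y u 2) * exp (-clockInt ε M Y u)
          ≤ m * exp (-clockInt ε M Y u) := by rw [hm]; exact h1
        _ ≤ k := by rw [hk]; exact mul_le_mul_of_nonneg_left h2 hm0)
  have h := hanti (left_mem_Icc.2 ht.1) (right_mem_Icc.2 ht.1) ht.1
  simp only [clockInt_zero, neg_zero, exp_zero, mul_one, mul_zero, sub_zero] at h
  -- h : Y t 2 * exp (-G t) - k * t ≤ Y 0 2
  have hc0 := (abs_le.1 (abs_init_coord_le h0).2.1).2
  have hGt : clockInt ε M Y t ≤ clockSup M ε δ δ₀ t := clockInt_le_clockSup hY hV hR hT h0 hδ₀ hε hM ht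
  have h3 : Y t 2 = (Y t 2 * exp (-clockInt ε M Y t)) * exp (clockInt ε M Y t) := by
    rw [mul_assoc, ← exp_add]; simp
  rw [h3]
  have h4 : Y t 2 * exp (-clockInt ε M Y t) ≤ δ₀ + k * t := by linarith
  have h5 : (Y t 2 * exp (-clockInt ε M Y t)) * exp (clockInt ε M Y t) ≤
      (δ₀ + k * t) * exp (clockInt ε M Y t) := mul_le_mul_of_nonneg_right h4 (exp_pos _).le
  refine h5.trans ?_
  have h6 : k * t * exp (clockInt ε M Y t) = m * t * exp (clockSup M ε δ δ₀ t) := by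
    rw [hk, mul_assoc m, mul_comm (exp _) t, ← mul_assoc, mul_assoc (m * t), ← exp_add]
    congr 2; ring
  have h7 : δ₀ * exp (clockInt ε M Y t) ≤ δ₀ * exp (clockSup M ε δ δ₀ t) :=
    mul_le_mul_of_nonneg_left (exp_le_exp.2 hGt) hδ₀0
  calc (δ₀ + k * t) * exp (clockInt ε M Y t)
      = δ₀ * exp (clockInt ε M Y t) + k * t * exp (clockInt ε M Y t) := by ring
    _ ≤ δ₀ * exp (clockSup M ε δ δ₀ t) + m * t * exp (clockSup M ε δ δ₀ t) := by
        rw [h6]; linarith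
    _ = (δ₀ + m * t) * exp (clockSup M ε δ δ₀ t) := by ring

/-- **A-priori lower bound on the trigger**: `c(t) ≥ -(δ₀ + δt)·e^{G⁺(t)}` on the window.
[cite: Tao2016AveragedNS, §5.5] -/
theorem c_ge (h0 : ‖Y 0 - delayInit‖ ≤ δ₀) (hδ₀ : δ₀ ≤ 1) (hε : 0 < ε) (hM : 0 ≤ M) {t : ℝ}
    (ht : t ∈ Icc (0 : ℝ) (8 / 5)) :
    -((δ₀ + δ * t) * exp (clockSup M ε δ δ₀ t)) ≤ Y t 2 := by
  have hδ := defect_nonneg hV hT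
  have hδ₀0 : 0 ≤ δ₀ := (norm_nonneg _).trans h0
  set k : ℝ := δ * exp (-clockInt ε M Y t + clockSup M ε δ δ₀ t) with hk
  have hmono := Thm53.monotoneOn_sub_of_le_deriv (s := Icc 0 t)
    (f := fun s => Y s 2 * exp (-clockInt ε M Y s)) (φ := fun _ => -k) (Φ := fun u => -k * u)
    (convex_Icc 0 t) (fun u _ => hasDerivAt_discA hY u)
    (fun u _ => by simpa using (hasDerivAt_id u).const_mul (-k)) (fun u hu => by
      have hu' : u ∈ Icc (0 : ℝ) (8 / 5) := ⟨hu.1, hu.2.trans ht.2⟩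
      have h1 := disc_deriv_geA hV hT hu' (K := K)
      have hG := clockInt_sub_leA hY hV hR hT h0 hδ₀ hε hM hu.1 hu.2 ht.2
      have hGu : 0 ≤ clockSup M ε δ δ₀ u := by
        have := clockSup_mono hM hε hδ hδ₀0 le_rfl hu.1 (M := M)
        rwa [clockSup_zero] at this
      have h2 : exp (-clockInt ε M Y u) ≤ exp (-clockInt ε M Y t + clockSup M ε δ δ₀ t) :=
        exp_le_exp.2 (by linarith)
      have h3 : 0 ≤ ε ^ 2 * exp (-M) * Y u 0 ^ 2 * exp (-clockInt ε M Y u) := by positivity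
      have h4 : δ * exp (-clockInt ε M Y u) ≤ k := by
        rw [hk]; exact mul_le_mul_of_nonneg_left h2 hδ
      calc -k ≤ -(δ * exp (-clockInt ε M Y u)) := by linarith
        _ ≤ (ε ^ 2 * exp (-M) * Y u 0 ^ 2 - δ) * exp (-clockInt ε M Y u) := by nlinarith
        _ ≤ _ := h1)
  have h := hmono (left_mem_Icc.2 ht.1) (right_mem_Icc.2 ht.1) ht.1
  simp only [clockInt_zero, neg_zero, exp_zero, mul_one, mul_zero, sub_zero] at h
  -- h : Y 0 2 ≤ Y t 2 * exp (-G t) - (-k * t)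
  have hc0 := (abs_le.1 (abs_init_coord_le h0).2.1).1
  have hGt : clockInt ε M Y t ≤ clockSup M ε δ δ₀ t := clockInt_le_clockSup hY hV hR hT h0 hδ₀ hε hM ht
  have h3 : Y t 2 = (Y t 2 * exp (-clockInt ε M Y t)) * exp (clockInt ε M Y t) := by
    rw [mul_assoc, ← exp_add]; simp
  rw [h3]
  have h4 : -(δ₀ + k * t) ≤ Y t 2 * exp (-clockInt ε M Y t) := by linarith
  have h5 : -(δ₀ + k * t) * exp (clockInt ε M Y t) ≤
      (Y t 2 * exp (-clockInt ε M Y t)) * exp (clockInt ε M Y t) :=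
    mul_le_mul_of_nonneg_right h4 (exp_pos _).le
  refine le_trans ?_ h5
  have h6 : k * t * exp (clockInt ε M Y t) = δ * t * exp (clockSup M ε δ δ₀ t) := by
    rw [hk, mul_assoc δ, mul_comm (exp _) t, ← mul_assoc, mul_assoc (δ * t), ← exp_add]
    congr 2; ring
  have h7 : δ₀ * exp (clockInt ε M Y t) ≤ δ₀ * exp (clockSup M ε δ δ₀ t) :=
    mul_le_mul_of_nonneg_left (exp_le_exp.2 hGt) hδ₀0
  have : (δ₀ + k * t) * exp (clockInt ε M Y t) ≤ (δ₀ + δ * t) * exp (clockSup M ε δ δ₀ t) := by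
    calc (δ₀ + k * t) * exp (clockInt ε M Y t)
        = δ₀ * exp (clockInt ε M Y t) + k * t * exp (clockInt ε M Y t) := by ring
      _ ≤ δ₀ * exp (clockSup M ε δ δ₀ t) + δ * t * exp (clockSup M ε δ δ₀ t) := by
          rw [h6]; linarith
      _ = (δ₀ + δ * t) * exp (clockSup M ε δ δ₀ t) := by ring
  linarith

/-! ## §3. The standing hypotheses and the seed-scale budget -/

omit hY hV hR hT in
/-- Numerical consequences of the standing hypotheses of the family used below.
[cite: Tao2016AveragedNS, Theorem 5.3] -/
theorem ignition_params (hK : 2 * 20 ^ 42 * (Nat.factorial 42 : ℝ) + 16 ≤ K)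
    (hML : 3000 * Real.log K ≤ M) (hMK : M ≤ K ^ 10) (hε : 0 < ε)
    (hεle : ε ≤ exp (-(10 * M)) / K ^ 100) :
    6000 ≤ M ∧ ε ≤ 1 ∧ ε ^ 2 ≤ 1 / 100000 ∧ exp (-M) ≤ 1 / 1000000 ∧ M * ε ≤ 1 / 40 ∧
      M ^ 2 * ε ^ 2 ≤ 1 / 2000 ∧ M * ε ^ 2 * exp (-M) ≤ 1 / 16000 ∧ 77 ≤ Real.sqrt M ∧
      Real.sqrt M ≤ M := by
  obtain ⟨hK16, hM4, hε1, -, hsmall, -⟩ := negKick_params hK hML hMK hε hεle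
  obtain ⟨hM6000, -, -, h16, -⟩ := NegKick.negKick_params_sharp hK hML hMK hε hεle
  have hM0 : 0 < M := by linarith
  obtain ⟨-, -, -, hε2⟩ := Thm53With.eps_facts hK16 hM0 hMK hε hεle
  have hε2' : ε ^ 2 ≤ 1 / 100000 := by
    refine hε2.trans ?_
    have h1 : exp (-(18 * M)) ≤ 1 := exp_le_one_iff.2 (by linarith)
    rw [div_le_div_iff₀ (by positivity) (by norm_num)]
    nlinarith
  have hexpM : exp (-M) ≤ 1 / 1000000 := by
    have h1 : M / 2 + 1 ≤ exp (M / 2) := add_one_le_exp (M / 2)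
    have h2 : (M / 2 + 1) ^ 2 ≤ exp M := by
      have : exp M = exp (M / 2) ^ 2 := by rw [← exp_nat_mul]; congr 1; ring
      rw [this]; exact pow_le_pow_left₀ (by positivity) h1 2
    have h3 : (1000000 : ℝ) ≤ (M / 2 + 1) ^ 2 := by nlinarith
    rw [exp_neg, inv_le_comm₀ (exp_pos M) (by norm_num), inv_div, div_one]
    linarith
  have hMe2 : M ^ 2 * ε ^ 2 ≤ 1 / 2000 := by
    have h1 : 1 ≤ exp (2 * M) := one_le_exp_iff.2 (by linarith)
    nlinarith [sq_nonneg (M * ε)]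
  have hMe : M * ε ≤ 1 / 40 := by nlinarith [mul_pos hM0 hε]
  have h77 : 77 ≤ Real.sqrt M :=
    calc (77 : ℝ) = Real.sqrt (77 ^ 2) := by rw [Real.sqrt_sq]; norm_num
      _ ≤ Real.sqrt M := Real.sqrt_le_sqrt (by nlinarith)
  have hsM : Real.sqrt M ≤ M :=
    calc Real.sqrt M ≤ Real.sqrt (M ^ 2) := Real.sqrt_le_sqrt (by nlinarith)
      _ = M := Real.sqrt_sq (by linarith)
  exact ⟨hM6000, hε1, hε2', hexpM, hMe, hMe2, by linarith, h77, hsM⟩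

section Eighth

/-! ## §3–§4 under the WEAK budget `δ₀ + 2δ ≤ ε²e^{-M}/8`

The a-priori bounds on `[0,1]`, the persistence lemma and the "clock keeps running" lemmas only use
the budget through `budget_facts'`; they are proved here once under the weak budget (primed names)
and re-exported below under the seed-scale budget `ε²e^{-M}/(8√M)` (unprimed names, unchanged
statements), so that sharper ignition thresholds (SeedScaleSharpIgnition.lean) can reuse them. -/

variable (hK : 2 * 20 ^ 42 * (Nat.factorial 42 : ℝ) + 16 ≤ K) (hML : 3000 * Real.log K ≤ M)
  (hMK : M ≤ K ^ 10) (hε : 0 < ε) (hεle : ε ≤ exp (-(10 * M)) / K ^ 100)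
  (h0 : ‖Y 0 - delayInit‖ ≤ δ₀) (hη : δ₀ + 2 * δ ≤ ε ^ 2 * exp (-M) / 8)
include hK hML hMK hε hεle h0 hη

omit hY hR in
/-- The WEAK seed-scale budget in absolute terms: under `δ₀ + 2δ ≤ ε²e^{-M}/8` one has
`δ₀, δ ≥ 0`, `δ₀ ≤ 1`, `7δ₀ + 32δ ≤ 2ε²e^{-M}` and `ε²e^{-M} ≤ 10⁻⁶`. (All a-priori bounds of §3–§4
below only use the budget through these facts; the seed-scale budget `ε²e^{-M}/(8√M)` of
`section Seed` implies the weak one, `budget_le_eighth`.) [cite: Tao2016AveragedNS, §5.5] -/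
theorem budget_facts' :
    0 ≤ δ₀ ∧ 0 ≤ δ ∧ δ₀ + 2 * δ ≤ ε ^ 2 * exp (-M) / 8 ∧ δ₀ ≤ 1 ∧
      7 * δ₀ + 32 * δ ≤ 2 * (ε ^ 2 * exp (-M)) ∧ ε ^ 2 * exp (-M) ≤ 1 / 1000000 := by
  obtain ⟨hM6000, hε1, hε2, hexpM, -, -, -, h77, -⟩ := ignition_params hK hML hMK hε hεle
  have hδ := defect_nonneg hV hT
  have hδ₀ : 0 ≤ δ₀ := (norm_nonneg _).trans h0
  have hs0 : 0 ≤ ε ^ 2 * exp (-M) := by positivity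
  have hs1 : ε ^ 2 * exp (-M) ≤ 1 / 1000000 := by
    have : exp (-M) ≤ 1 := by linarith
    nlinarith
  exact ⟨hδ₀, hδ, hη, by linarith, by linarith, hs1⟩

omit hY hR in
/-- **The majorant clock on the window**: `G⁺(t) ≤ Mt²/2 + t²/16000 + t/320` for `t ∈ [0, 8/5]`.
[cite: Tao2016AveragedNS, §5.5] -/
theorem clockSup_le' {t : ℝ} (ht : t ∈ Icc (0 : ℝ) (8 / 5)) :
    clockSup M ε δ δ₀ t ≤ M * t ^ 2 / 2 + t ^ 2 / 16000 + t / 320 := by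
  obtain ⟨hM6000, hε1, -, hexpM, hMe, -, hMse, -, -⟩ := ignition_params hK hML hMK hε hεle
  obtain ⟨hδ₀, hδ, hη8, -, h732, -⟩ := budget_facts' hV hT hK hML hMK hε hεle h0 hη
  have hM0 : 0 < M := by linarith
  have hsplit : clockSup M ε δ δ₀ t =
      M * t ^ 2 / 2 + M * t ^ 2 / 2 * (7 * δ₀ + 32 * δ) + ε⁻¹ * M * (δ₀ * t + δ * t ^ 2 / 2) := by
    unfold clockSup; field_simp; ring
  rw [hsplit]
  have h1 : M * t ^ 2 / 2 * (7 * δ₀ + 32 * δ) ≤ t ^ 2 / 16000 := by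
    have : M * (7 * δ₀ + 32 * δ) ≤ 2 * (M * ε ^ 2 * exp (-M)) := by nlinarith
    nlinarith [sq_nonneg t]
  have h2 : ε⁻¹ * M * (δ₀ * t + δ * t ^ 2 / 2) ≤ t / 320 := by
    have h21 : δ₀ * t + δ * t ^ 2 / 2 ≤ (δ₀ + 2 * δ) * t := by
      have : 0 ≤ δ * t * (4 - t) := mul_nonneg (mul_nonneg hδ ht.1) (by linarith [ht.2])
      nlinarith
    have h22 : ε⁻¹ * M * ((δ₀ + 2 * δ) * t) ≤ ε⁻¹ * M * (ε ^ 2 * exp (-M) / 8 * t) :=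
      mul_le_mul_of_nonneg_left (mul_le_mul_of_nonneg_right hη8 ht.1) (by positivity)
    have h23 : ε⁻¹ * M * (ε ^ 2 * exp (-M) / 8 * t) = M * ε * exp (-M) / 8 * t := by
      field_simp
    have h24 : M * ε * exp (-M) ≤ 1 / 40 := by
      have : exp (-M) ≤ 1 := by linarith
      nlinarith [mul_pos hM0 hε]
    calc ε⁻¹ * M * (δ₀ * t + δ * t ^ 2 / 2) ≤ ε⁻¹ * M * ((δ₀ + 2 * δ) * t) :=
          mul_le_mul_of_nonneg_left h21 (by positivity)
      _ ≤ M * ε * exp (-M) / 8 * t := by rw [← h23]; exact h22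
      _ ≤ t / 320 := by nlinarith [ht.1]
  linarith
set_option maxHeartbeats 400000 in -- buildfix (bf3-g30): 160k/180k FAIL, 200k PASS at accept time; line-neutral budget line
/-- **The trigger on the first unit of time**: `|c(t)| ≤ 3ε²e^{-M/2}` for `t ∈ [0,1]`
(budget `≤ ε²e^{-M}/8`, clock `G⁺(1) ≤ M/2 + 1/50`). [cite: Tao2016AveragedNS, §5.5] -/
theorem abs_c_le_unit' {t : ℝ} (ht : t ∈ Icc (0 : ℝ) 1) :
    |Y t 2| ≤ 3 * ε ^ 2 * exp (-(M / 2)) := by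
  obtain ⟨hM6000, hε1, -, hexpM, hMe, -, hMse, -, -⟩ := ignition_params hK hML hMK hε hεle
  obtain ⟨hδ₀, hδ, hη8, hδ₀1, h732, hs1⟩ := budget_facts' hV hT hK hML hMK hε hεle h0 hη
  have hM : 0 ≤ M := by linarith
  have ht' : t ∈ Icc (0 : ℝ) (8 / 5) := ⟨ht.1, by linarith [ht.2]⟩
  have hup := c_le hY hV hR hT h0 hδ₀1 hε hM ht'
  have hlo := c_ge hY hV hR hT h0 hδ₀1 hε hM ht'
  have hG1 : clockSup M ε δ δ₀ t ≤ M / 2 + 1 / 50 := by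
    have h1 := clockSup_le' hV hT hK hML hMK hε hεle h0 hη ht'
    have ht2 : t ^ 2 ≤ 1 := pow_le_one₀ ht.1 ht.2
    have h2 : M * t ^ 2 ≤ M := by nlinarith
    linarith [ht.2]
  -- e^{G⁺(t)} ≤ (50/49)·e^{M/2}
  have he50 : exp (1 / 50 : ℝ) ≤ 50 / 49 := by
    have h := add_one_le_exp (-(1 / 50 : ℝ))
    have h' : exp (1 / 50 : ℝ) * exp (-(1 / 50 : ℝ)) = 1 := by rw [← exp_add]; simp
    nlinarith [exp_pos (1 / 50 : ℝ), exp_pos (-(1 / 50 : ℝ))]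
  have hexpG : exp (clockSup M ε δ δ₀ t) ≤ 50 / 49 * exp (M / 2) := by
    calc exp (clockSup M ε δ δ₀ t) ≤ exp (M / 2 + 1 / 50) := exp_le_exp.2 hG1
      _ = exp (1 / 50) * exp (M / 2) := by rw [← exp_add]; ring_nf
      _ ≤ 50 / 49 * exp (M / 2) := mul_le_mul_of_nonneg_right he50 (exp_pos _).le
  set s : ℝ := ε ^ 2 * exp (-M) with hs
  have hs0 : 0 < s := by positivity
  have hpre : δ₀ + (s * (1 + 7 * δ₀ + 32 * δ) + δ) * t ≤ 9 / 4 * s := by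
    have h1 : s * (1 + 7 * δ₀ + 32 * δ) ≤ s * (1 + 2 * s) := by nlinarith
    have h2 : (s * (1 + 7 * δ₀ + 32 * δ) + δ) * t ≤ s * (1 + 2 * s) + δ := by
      have : 0 ≤ s * (1 + 7 * δ₀ + 32 * δ) + δ := by positivity
      nlinarith [ht.2]
    nlinarith
  have hpre' : δ₀ + δ * t ≤ 9 / 4 * s := by
    have : δ * t ≤ (s * (1 + 7 * δ₀ + 32 * δ) + δ) * t := by
      apply mul_le_mul_of_nonneg_right _ ht.1; nlinarith
    linarith
  have hkey : 9 / 4 * s * (50 / 49 * exp (M / 2)) ≤ 3 * ε ^ 2 * exp (-(M / 2)) := by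
    have : s * exp (M / 2) = ε ^ 2 * exp (-(M / 2)) := by
      rw [hs, mul_assoc, ← exp_add]; ring_nf
    nlinarith [exp_pos (M / 2)]
  have hE : 0 ≤ exp (clockSup M ε δ δ₀ t) := (exp_pos _).le
  rw [abs_le]; constructor
  · have : (δ₀ + δ * t) * exp (clockSup M ε δ δ₀ t) ≤ 9 / 4 * s * (50 / 49 * exp (M / 2)) :=
      mul_le_mul hpre' hexpG hE (by positivity)
    linarith
  · have : (δ₀ + (s * (1 + 7 * δ₀ + 32 * δ) + δ) * t) * exp (clockSup M ε δ δ₀ t) ≤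
        9 / 4 * s * (50 / 49 * exp (M / 2)) := mul_le_mul hpre hexpG hE (by positivity)
    linarith

/-- **The clock on the first unit of time**: `-ε ≤ b(t) ≤ 2ε` for `t ∈ [0,1]`.
[cite: Tao2016AveragedNS, §5.5 (5.5)] -/
theorem b_bounds_unit' {t : ℝ} (ht : t ∈ Icc (0 : ℝ) 1) : -ε ≤ Y t 1 ∧ Y t 1 ≤ 2 * ε := by
  obtain ⟨hM6000, hε1, -, hexpM, hMe, -, hMse, -, -⟩ := ignition_params hK hML hMK hε hεle
  obtain ⟨hδ₀, hδ, hη8, hδ₀1, h732, hs1⟩ := budget_facts' hV hT hK hML hMK hε hεle h0 hη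
  have hM : 0 ≤ M := by linarith
  have ht' : t ∈ Icc (0 : ℝ) (8 / 5) := ⟨ht.1, by linarith [ht.2]⟩
  constructor
  · -- ḃ ≥ -ε⁻¹MC₁² - δ with C₁ = 3ε²e^{-M/2}
    set C : ℝ := 3 * ε ^ 2 * exp (-(M / 2)) with hC
    have hC2 : ε⁻¹ * M * C ^ 2 = 9 * M * ε ^ 3 * exp (-M) := by
      have : exp (-(M / 2)) ^ 2 = exp (-M) := by rw [← exp_nat_mul]; ring_nf
      rw [hC, mul_pow, mul_pow, this]; field_simp; ring
    set β : ℝ := ε⁻¹ * M * C ^ 2 + δ with hβ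
    have hβ0 : 0 ≤ β := by rw [hβ]; positivity
    have hmono := Thm53.monotoneOn_sub_of_le_deriv (s := Icc (0 : ℝ) 1) (f := fun s => Y s 1)
      (φ := fun _ => -β) (Φ := fun u => -β * u)
      (convex_Icc 0 1) (fun u _ => hasDerivAt_coord (hY u) 1)
      (fun u _ => by simpa using (hasDerivAt_id u).const_mul (-β))
      (fun u hu => by
        have hu' : u ∈ Icc (0 : ℝ) (8 / 5) := ⟨hu.1, by linarith [hu.2]⟩
        have hθ := (abs_le.1 (abs_coord_defect_le (hV u (mem_Ico_of_mem_window hT hu')) 1)).1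
        rw [field_one] at hθ
        have hc : Y u 2 ^ 2 ≤ C ^ 2 := by
          have := abs_c_le_unit' hY hV hR hT hK hML hMK hε hεle h0 hη hu
          rw [← sq_abs]; exact pow_le_pow_left₀ (abs_nonneg _) this 2
        have h1 : 0 ≤ ε * Y u 0 ^ 2 := by positivity
        have h2 : ε⁻¹ * M * Y u 2 ^ 2 ≤ ε⁻¹ * M * C ^ 2 :=
          mul_le_mul_of_nonneg_left hc (by positivity)
        show -β ≤ V u 1
        linarith)
    have h := hmono (left_mem_Icc.2 zero_le_one) ht ht.1
    have hb0 := (abs_le.1 (abs_init_coord_le h0).1).1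
    simp only [mul_zero, sub_zero] at h
    have h3 : β * t ≤ β := by nlinarith [ht.2]
    have h4 : 9 * M * ε ^ 3 * exp (-M) ≤ ε / 1000 := by
      have := mul_le_mul_of_nonneg_left hMse (by positivity : (0 : ℝ) ≤ 9 * ε)
      nlinarith
    have h5 : δ₀ + δ ≤ ε / 8 := by
      have : ε ^ 2 * exp (-M) ≤ ε := by nlinarith
      linarith
    have h6 : β = 9 * M * ε ^ 3 * exp (-M) + δ := by rw [hβ, hC2]
    nlinarith
  · have h := b_le hY hV hR hT h0 hδ₀1 hε hM ht'
    have h1 : (ε * (1 + 7 * δ₀ + 32 * δ) + δ) * t ≤ ε * (1 + 7 * δ₀ + 32 * δ) + δ := by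
      have : 0 ≤ ε * (1 + 7 * δ₀ + 32 * δ) + δ := by positivity
      nlinarith [ht.2]
    have h2 : ε * (7 * δ₀ + 32 * δ) ≤ ε / 4 := by nlinarith
    have h3 : δ₀ + δ ≤ ε / 8 := by nlinarith
    nlinarith
set_option maxHeartbeats 400000 in -- buildfix (bf3-g30): 160k/180k FAIL, 200k PASS at accept time; line-neutral budget line
/-- **The outputs on the first unit of time**: `|d(t)|, |ã(t)| ≤ 7e^{-M/2}` for `t ∈ [0,1]`
(the rotor drive is `ε⁻²|c||a| ≤ 6e^{-M/2}`, plus the defect). [cite: Tao2016AveragedNS, §5.5 (5.5)] -/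
theorem de_le_unit' {t : ℝ} (ht : t ∈ Icc (0 : ℝ) 1) :
    |Y t 3| ≤ 7 * exp (-(M / 2)) ∧ |Y t 4| ≤ 7 * exp (-(M / 2)) := by
  obtain ⟨hM6000, hε1, -, hexpM, hMe, -, hMse, -, -⟩ := ignition_params hK hML hMK hε hεle
  obtain ⟨hδ₀, hδ, hη8, hδ₀1, h732, hs1⟩ := budget_facts' hV hT hK hML hMK hε hεle h0 hη
  set ρ : ℝ := 2 * δ + 6 * exp (-(M / 2)) with hρ
  have hρ0 : 0 ≤ ρ := by positivity
  set u : ℝ → ℝ := fun s => Y s 3 * Y s 3 + Y s 4 * Y s 4 with hu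
  obtain ⟨hd0, he0⟩ := (abs_init_coord_le h0).2.2
  suffices hmain : ∀ μ : ℝ, 0 < μ → Real.sqrt (u t + μ ^ 2) ≤ 2 * δ₀ + μ + ρ * t by
    have hfin : 2 * δ₀ + ρ * t ≤ 7 * exp (-(M / 2)) := by
      have h1 : ρ * t ≤ ρ := by nlinarith [ht.2]
      have h2 : 2 * δ₀ + 2 * δ ≤ exp (-(M / 2)) := by
        have h21 : ε ^ 2 * exp (-M) ≤ exp (-(M / 2)) :=
          calc ε ^ 2 * exp (-M) ≤ 1 * exp (-M) :=
                mul_le_mul_of_nonneg_right (by nlinarith) (exp_pos _).le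
            _ ≤ exp (-(M / 2)) := by rw [one_mul]; exact exp_le_exp.2 (by linarith)
        linarith
      linarith
    have hd : ∀ μ : ℝ, 0 < μ → |Y t 3| ≤ 7 * exp (-(M / 2)) + μ := fun μ hμ => by
      have : |Y t 3| ≤ Real.sqrt (u t + μ ^ 2) :=
        abs_le_sqrt (by simp only [hu]; nlinarith [mul_self_nonneg (Y t 4)])
      linarith [hmain μ hμ]
    have he : ∀ μ : ℝ, 0 < μ → |Y t 4| ≤ 7 * exp (-(M / 2)) + μ := fun μ hμ => by
      have : |Y t 4| ≤ Real.sqrt (u t + μ ^ 2) :=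
        abs_le_sqrt (by simp only [hu]; nlinarith [mul_self_nonneg (Y t 3)])
      linarith [hmain μ hμ]
    exact ⟨le_of_forall_pos_le_add fun μ hμ => hd μ hμ,
      le_of_forall_pos_le_add fun μ hμ => he μ hμ⟩
  intro μ hμ
  set h : ℝ → ℝ := fun s => Real.sqrt (u s + μ ^ 2) with hh
  have hupos : ∀ s, 0 < u s + μ ^ 2 := fun s => by
    have : 0 ≤ u s := by simp only [hu]; nlinarith [mul_self_nonneg (Y s 3), mul_self_nonneg (Y s 4)]
    positivity
  have hdu : ∀ s, HasDerivAt u (Y s 3 * V s 3 + Y s 3 * V s 3 + (Y s 4 * V s 4 + Y s 4 * V s 4)) s :=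
    fun s => by
      have h3 := hasDerivAt_coord (hY s) 3
      have h4 := hasDerivAt_coord (hY s) 4
      exact ((h3.mul h3).add (h4.mul h4)).congr_deriv (by ring)
  have hder : ∀ s, HasDerivAt h
      ((Y s 3 * V s 3 + Y s 3 * V s 3 + (Y s 4 * V s 4 + Y s 4 * V s 4)) /
        (2 * Real.sqrt (u s + μ ^ 2))) s := fun s =>
    ((hdu s).add_const (μ ^ 2)).sqrt (hupos s).ne'
  have hbound : ∀ s ∈ Icc (0 : ℝ) 1,
      (Y s 3 * V s 3 + Y s 3 * V s 3 + (Y s 4 * V s 4 + Y s 4 * V s 4)) /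
        (2 * Real.sqrt (u s + μ ^ 2)) ≤ ρ := by
    intro s hs
    have hs' : s ∈ Icc (0 : ℝ) (8 / 5) := ⟨hs.1, by linarith [hs.2]⟩
    have hhpos : 0 < Real.sqrt (u s + μ ^ 2) := Real.sqrt_pos.2 (hupos s)
    rw [div_le_iff₀ (by positivity)]
    have hVs := hV s (mem_Ico_of_mem_window hT hs')
    have hθ3 := abs_coord_defect_le hVs 3
    have hθ4 := abs_coord_defect_le hVs 4
    rw [field_three] at hθ3
    rw [field_four] at hθ4
    have hcs : |Y s 2| ≤ 3 * ε ^ 2 * exp (-(M / 2)) :=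
      abs_c_le_unit' hY hV hR hT hK hML hMK hε hεle h0 hη hs
    have ha : |Y s 0| ≤ 2 := abs_apply_le_of_norm_le (hR s (mem_Ico_of_mem_window hT hs')) 0
    have hds : |Y s 3| ≤ Real.sqrt (u s + μ ^ 2) :=
      abs_le_sqrt (by simp only [hu]; nlinarith [mul_self_nonneg (Y s 4)])
    have hes : |Y s 4| ≤ Real.sqrt (u s + μ ^ 2) :=
      abs_le_sqrt (by simp only [hu]; nlinarith [mul_self_nonneg (Y s 3)])
    -- split V₃ = F₃ + θ₃, V₄ = F₄ + θ₄; the pump terms cancel: d·F₃ + ã·F₄ = ε⁻²·c·a·d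
    have hid : Y s 3 * V s 3 + Y s 4 * V s 4 =
        Y s 3 * (V s 3 - ((ε ^ 2)⁻¹ * Y s 2 * Y s 0 - K * Y s 3 * Y s 4)) +
        Y s 4 * (V s 4 - K * Y s 3 ^ 2) + (ε ^ 2)⁻¹ * (Y s 2 * Y s 0 * Y s 3) := by ring
    have h1 : |Y s 3 * (V s 3 - ((ε ^ 2)⁻¹ * Y s 2 * Y s 0 - K * Y s 3 * Y s 4))| ≤
        Real.sqrt (u s + μ ^ 2) * δ := by
      rw [abs_mul]; exact mul_le_mul hds hθ3 (abs_nonneg _) hhpos.le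
    have h2 : |Y s 4 * (V s 4 - K * Y s 3 ^ 2)| ≤ Real.sqrt (u s + μ ^ 2) * δ := by
      rw [abs_mul]; exact mul_le_mul hes hθ4 (abs_nonneg _) hhpos.le
    have h3 : |(ε ^ 2)⁻¹ * (Y s 2 * Y s 0 * Y s 3)| ≤
        (ε ^ 2)⁻¹ * (3 * ε ^ 2 * exp (-(M / 2)) * 2 * Real.sqrt (u s + μ ^ 2)) := by
      rw [abs_mul, abs_of_pos (by positivity : (0 : ℝ) < (ε ^ 2)⁻¹), abs_mul, abs_mul]
      refine mul_le_mul_of_nonneg_left ?_ (by positivity)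
      exact mul_le_mul (mul_le_mul hcs ha (abs_nonneg _) (by positivity)) hds (abs_nonneg _)
        (by positivity)
    have h3' : (ε ^ 2)⁻¹ * (3 * ε ^ 2 * exp (-(M / 2)) * 2 * Real.sqrt (u s + μ ^ 2)) =
        6 * exp (-(M / 2)) * Real.sqrt (u s + μ ^ 2) := by field_simp; ring
    rw [h3'] at h3
    have e1 := (le_abs_self _).trans h1
    have e2 := (le_abs_self _).trans h2
    have e3 := (le_abs_self _).trans h3
    have hsum : Y s 3 * V s 3 + Y s 4 * V s 4 ≤ ρ * Real.sqrt (u s + μ ^ 2) := by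
      rw [hid, hρ]
      linarith
    linarith
  have hanti := Thm53.antitoneOn_sub_of_deriv_le (Φ := fun s => ρ * s)
    (convex_Icc (0 : ℝ) 1) (fun s _ => hder s)
    (fun s _ => ((hasDerivAt_id s).const_mul ρ).congr_deriv (by simp)) hbound
  have hmono := hanti (left_mem_Icc.2 zero_le_one) ht ht.1
  have hh0 : h 0 ≤ 2 * δ₀ + μ := by
    simp only [hh, hu]
    have hsq : Y 0 3 * Y 0 3 + Y 0 4 * Y 0 4 + μ ^ 2 ≤ (|Y 0 3| + |Y 0 4| + μ) ^ 2 :=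
      sq_add_sq_add_sq_le _ _ _ hμ.le
    calc Real.sqrt (Y 0 3 * Y 0 3 + Y 0 4 * Y 0 4 + μ ^ 2)
        ≤ Real.sqrt ((|Y 0 3| + |Y 0 4| + μ) ^ 2) := Real.sqrt_le_sqrt hsq
      _ = |Y 0 3| + |Y 0 4| + μ := Real.sqrt_sq (by positivity)
      _ ≤ 2 * δ₀ + μ := by linarith
  simp only [mul_zero, sub_zero] at hmono
  show h t ≤ 2 * δ₀ + μ + ρ * t
  linarith

/-- **The carrier on the first unit of time**: `a(t)² ≥ 999/1000` for `t ∈ [0,1]`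
(energy `≥ 1 - 2ε²e^{-M}`, and `b², c², d², ã²` are `≤ 4ε², 9ε⁴e^{-M}, 49e^{-M}, 49e^{-M}`).
[cite: Tao2016AveragedNS, §5.5 (energy-con)] -/
theorem a_sq_ge_unit' {t : ℝ} (ht : t ∈ Icc (0 : ℝ) 1) : 999 / 1000 ≤ Y t 0 ^ 2 := by
  obtain ⟨hM6000, hε1, hε2, hexpM, hMe, -, hMse, -, -⟩ := ignition_params hK hML hMK hε hεle
  obtain ⟨hδ₀, hδ, hη8, hδ₀1, h732, hs1⟩ := budget_facts' hV hT hK hML hMK hε hεle h0 hη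
  have ht' : t ∈ Icc (0 : ℝ) (8 / 5) := ⟨ht.1, by linarith [ht.2]⟩
  have hE := (abs_le.1 (abs_energy_sub_one_le hY hV hR hT h0 hδ₀1 ht')).1
  rw [energy_five] at hE
  obtain ⟨hb1, hb2⟩ := b_bounds_unit' hY hV hR hT hK hML hMK hε hεle h0 hη ht
  have hc := abs_c_le_unit' hY hV hR hT hK hML hMK hε hεle h0 hη ht
  obtain ⟨hd, he⟩ := de_le_unit' hY hV hR hT hK hML hMK hε hεle h0 hη ht
  have hb : Y t 1 ^ 2 ≤ 4 * ε ^ 2 := by nlinarith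
  have hsq : ∀ x C : ℝ, |x| ≤ C → x ^ 2 ≤ C ^ 2 := fun x C h => by
    rw [← sq_abs]; exact pow_le_pow_left₀ (abs_nonneg x) h 2
  have hc2 := hsq _ _ hc
  have hd2 := hsq _ _ hd
  have he2 := hsq _ _ he
  have hex : exp (-(M / 2)) ^ 2 = exp (-M) := by rw [← exp_nat_mul]; ring_nf
  have h1 : (3 * ε ^ 2 * exp (-(M / 2))) ^ 2 ≤ 1 / 1000000 := by
    rw [mul_pow, hex]; nlinarith
  have h2 : (7 * exp (-(M / 2))) ^ 2 ≤ 49 / 1000000 := by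
    rw [mul_pow, hex]; nlinarith
  nlinarith

/-- **The clock on the first unit of time, from below**: `b(t) ≥ -δ₀ + (99/100)εt` on `[0,1]`
(`ḃ ≥ (999/1000)ε - 9Mε³e^{-M} - δ`). [cite: Tao2016AveragedNS, §5.5 (5.5)] -/
theorem b_ge_unit' {t : ℝ} (ht : t ∈ Icc (0 : ℝ) 1) : -δ₀ + 99 / 100 * ε * t ≤ Y t 1 := by
  obtain ⟨hM6000, hε1, -, hexpM, hMe, -, hMse, -, -⟩ := ignition_params hK hML hMK hε hεle
  obtain ⟨hδ₀, hδ, hη8, hδ₀1, h732, hs1⟩ := budget_facts' hV hT hK hML hMK hε hεle h0 hη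
  set C : ℝ := 3 * ε ^ 2 * exp (-(M / 2)) with hC
  have hC2 : ε⁻¹ * M * C ^ 2 = 9 * M * ε ^ 3 * exp (-M) := by
    have : exp (-(M / 2)) ^ 2 = exp (-M) := by rw [← exp_nat_mul]; ring_nf
    rw [hC, mul_pow, mul_pow, this]; field_simp; ring
  have hrate : 99 / 100 * ε ≤ ε * (999 / 1000) - (ε⁻¹ * M * C ^ 2 + δ) := by
    rw [hC2]
    have h4 : 9 * M * ε ^ 3 * exp (-M) ≤ ε / 1000 := by nlinarith
    have h5 : δ ≤ ε / 1000 := by nlinarith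
    nlinarith
  have hmono := Thm53.monotoneOn_sub_of_le_deriv (s := Icc (0 : ℝ) 1) (f := fun s => Y s 1)
    (φ := fun _ => 99 / 100 * ε) (Φ := fun u => 99 / 100 * ε * u)
    (convex_Icc 0 1) (fun u _ => hasDerivAt_coord (hY u) 1)
    (fun u _ => by simpa using (hasDerivAt_id u).const_mul (99 / 100 * ε))
    (fun u hu => by
      have hu' : u ∈ Icc (0 : ℝ) (8 / 5) := ⟨hu.1, by linarith [hu.2]⟩
      have hθ := (abs_le.1 (abs_coord_defect_le (hV u (mem_Ico_of_mem_window hT hu')) 1)).1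
      rw [field_one] at hθ
      have hc : Y u 2 ^ 2 ≤ C ^ 2 := by
        have := abs_c_le_unit' hY hV hR hT hK hML hMK hε hεle h0 hη hu
        rw [← sq_abs]; exact pow_le_pow_left₀ (abs_nonneg _) this 2
      have ha := a_sq_ge_unit' hY hV hR hT hK hML hMK hε hεle h0 hη hu
      have h1 : ε * (999 / 1000) ≤ ε * Y u 0 ^ 2 := mul_le_mul_of_nonneg_left ha hε.le
      have h2 : ε⁻¹ * M * Y u 2 ^ 2 ≤ ε⁻¹ * M * C ^ 2 :=
        mul_le_mul_of_nonneg_left hc (by positivity)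
      linarith)
  have h := hmono (left_mem_Icc.2 zero_le_one) ht ht.1
  have hb0 := (abs_le.1 (abs_init_coord_le h0).1).1
  simp only [mul_zero, sub_zero] at h
  linarith

/-- **The clock integral on the first unit of time, from below**:
`G(u) ≥ (99/200)Mu² - ε⁻¹Mδ₀u ≥ (99/200)Mu² - 1/320` on `[0,1]`. [cite: Tao2016AveragedNS, §5.5] -/
theorem clockInt_ge_unit' {u : ℝ} (hu : u ∈ Icc (0 : ℝ) 1) :
    99 / 200 * M * u ^ 2 - 1 / 320 ≤ clockInt ε M Y u := by
  obtain ⟨hM6000, hε1, -, hexpM, hMe, -, hMse, -, -⟩ := ignition_params hK hML hMK hε hεle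
  obtain ⟨hδ₀, hδ, hη8, hδ₀1, h732, hs1⟩ := budget_facts' hV hT hK hML hMK hε hεle h0 hη
  have hM0 : 0 < M := by linarith
  have hmono := Thm53.monotoneOn_sub_of_le_deriv (s := Icc (0 : ℝ) 1) (f := clockInt ε M Y)
    (φ := fun r => ε⁻¹ * M * (-δ₀ + 99 / 100 * ε * r))
    (Φ := fun r => ε⁻¹ * M * (-δ₀ * r + 99 / 100 * ε * r ^ 2 / 2)) (convex_Icc 0 1)
    (fun r _ => hasDerivAt_clockIntA hY r)
    (fun r _ => by
      have h := (((hasDerivAt_id' r).const_mul (-δ₀)).add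
        (((hasDerivAt_pow 2 r).const_mul (99 / 100 * ε)).div_const 2)).const_mul (ε⁻¹ * M)
      refine h.congr_deriv ?_
      have e : ((2 : ℕ) : ℝ) * r ^ (2 - 1) = 2 * r := by norm_num
      rw [e]; ring)
    (fun r hr => mul_le_mul_of_nonneg_left
      (b_ge_unit' hY hV hR hT hK hML hMK hε hεle h0 hη hr) (by positivity))
  have h := hmono (left_mem_Icc.2 zero_le_one) hu hu.1
  simp only [clockInt_zero, mul_zero] at h
  have h1 : ε⁻¹ * M * (-δ₀ * u + 99 / 100 * ε * u ^ 2 / 2) =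
      99 / 200 * M * u ^ 2 - ε⁻¹ * M * δ₀ * u := by field_simp; ring
  have h2 : ε⁻¹ * M * δ₀ * u ≤ 1 / 320 := by
    have h21 : ε⁻¹ * M * δ₀ ≤ ε⁻¹ * M * (ε ^ 2 * exp (-M) / 8) :=
      mul_le_mul_of_nonneg_left (by linarith) (by positivity)
    have h22 : ε⁻¹ * M * (ε ^ 2 * exp (-M) / 8) = M * ε * exp (-M) / 8 := by field_simp
    have h23 : M * ε * exp (-M) ≤ 1 / 40 := by
      have : exp (-M) ≤ 1 := by linarith
      nlinarith [mul_pos hM0 hε]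
    have h24 : 0 ≤ ε⁻¹ * M * δ₀ := by positivity
    nlinarith [hu.1, hu.2]
  nlinarith [h, h1, h2]

omit hR in
/-- **Persistence of the discounted trigger**: if `G ≥ -1/100` on `[0,τ]`, `τ ≤ 8/5`, then
`D(t) ≥ D(r) - (102/100)δ(t - r)` for `0 ≤ r ≤ t ≤ τ` (`D' ≥ -δe^{-G}`). [cite: Tao2016AveragedNS, §5.5] -/
theorem disc_persist' {τ : ℝ} (hτ : τ ≤ 8 / 5)
    (hG : ∀ u ∈ Icc (0 : ℝ) τ, -(1 / 100) ≤ clockInt ε M Y u) {r t : ℝ} (hr : 0 ≤ r)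
    (hrt : r ≤ t) (ht : t ≤ τ) :
    Y r 2 * exp (-clockInt ε M Y r) - 102 / 100 * δ * (t - r) ≤
      Y t 2 * exp (-clockInt ε M Y t) := by
  obtain ⟨hδ₀, hδ, -, -, -, -⟩ := budget_facts' hV hT hK hML hMK hε hεle h0 hη
  have he : exp (1 / 100 : ℝ) ≤ 102 / 100 := by
    have h := add_one_le_exp (-(1 / 100 : ℝ))
    have h' : exp (1 / 100 : ℝ) * exp (-(1 / 100 : ℝ)) = 1 := by rw [← exp_add]; simp
    nlinarith [exp_pos (1 / 100 : ℝ), exp_pos (-(1 / 100 : ℝ))]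
  have hmono := Thm53.monotoneOn_sub_of_le_deriv (s := Icc (0 : ℝ) τ)
    (f := fun s => Y s 2 * exp (-clockInt ε M Y s)) (φ := fun _ => -(102 / 100 * δ))
    (Φ := fun u => -(102 / 100 * δ) * u) (convex_Icc 0 τ) (fun u _ => hasDerivAt_discA hY u)
    (fun u _ => by simpa using (hasDerivAt_id u).const_mul (-(102 / 100 * δ)))
    (fun u hu => by
      have hu' : u ∈ Icc (0 : ℝ) (8 / 5) := ⟨hu.1, hu.2.trans hτ⟩
      have h1 := disc_deriv_geA hV hT hu' (K := K)
      have h2 : exp (-clockInt ε M Y u) ≤ 102 / 100 :=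
        (exp_le_exp.2 (by linarith [hG u hu])).trans he
      have h3 : 0 ≤ ε ^ 2 * exp (-M) * Y u 0 ^ 2 * exp (-clockInt ε M Y u) := by positivity
      have h4 : δ * exp (-clockInt ε M Y u) ≤ 102 / 100 * δ := by nlinarith [exp_pos (-clockInt ε M Y u)]
      nlinarith [exp_pos (-clockInt ε M Y u)])
  have h := hmono ⟨hr, hrt.trans ht⟩ ⟨hr.trans hrt, ht⟩ hrt
  simp only at h
  linarith

/-! ## §4. If the trigger stayed below `ε²`: the clock keeps running and the deposit is amplified -/

omit hR h0 hη in
/-- If `|c| ≤ ε²` on the window, the clock decays at most at rate `Mε³ + δ` there: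
`b(t) ≥ b(r) - (Mε³ + δ)(t - r)` for `0 ≤ r ≤ t ≤ 8/5` (`ḃ ≥ -ε⁻¹Mc² - δ ≥ -(Mε³ + δ)`).
[cite: Tao2016AveragedNS, §5.5 (5.5)] -/
theorem b_sub_ge_of_small (hc : ∀ t ∈ Icc (0 : ℝ) (8 / 5), |Y t 2| ≤ ε ^ 2) {r t : ℝ}
    (hr : 0 ≤ r) (hrt : r ≤ t) (ht : t ≤ 8 / 5) :
    Y r 1 - (M * ε ^ 3 + δ) * (t - r) ≤ Y t 1 := by
  obtain ⟨hM6000, -, -, -, -, -, -, -, -⟩ := ignition_params hK hML hMK hε hεle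
  obtain ⟨k, hk⟩ : ∃ k : ℝ, k = M * ε ^ 3 + δ := ⟨_, rfl⟩
  have hmono := Thm53.monotoneOn_sub_of_le_deriv (s := Icc (0 : ℝ) (8 / 5)) (f := fun s => Y s 1)
    (φ := fun _ => -k) (Φ := fun u => -k * u) (convex_Icc 0 _)
    (fun u _ => hasDerivAt_coord (hY u) 1)
    (fun u _ => by simpa using (hasDerivAt_id u).const_mul (-k))
    (fun u hu => by
      have hθ := (abs_le.1 (abs_coord_defect_le (hV u (mem_Ico_of_mem_window hT hu)) 1)).1
      rw [field_one] at hθ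
      have hc2 : Y u 2 ^ 2 ≤ (ε ^ 2) ^ 2 := by
        rw [← sq_abs]; exact pow_le_pow_left₀ (abs_nonneg _) (hc u hu) 2
      have h1 : 0 ≤ ε * Y u 0 ^ 2 := by
        have : (0 : ℝ) ≤ M := by linarith
        positivity
      have h2 : ε⁻¹ * M * Y u 2 ^ 2 ≤ ε⁻¹ * M * (ε ^ 2) ^ 2 :=
        mul_le_mul_of_nonneg_left hc2 (by have : (0 : ℝ) ≤ M := by linarith
                                          positivity)
      have h3 : ε⁻¹ * M * (ε ^ 2) ^ 2 = M * ε ^ 3 := by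
        field_simp
      show -k ≤ V u 1
      rw [hk]; linarith)
  have h := hmono ⟨hr, hrt.trans ht⟩ ⟨hr.trans hrt, ht⟩ hrt
  simp only at h
  rw [← hk]; linarith

omit hR in
/-- If `|c| ≤ ε²` on the window, the clock integral stays `≥ -1/100` there
(`b ≥ -δ₀ - (8/5)(Mε³ + δ)`, and `ε⁻¹M` times that is `≤ 1/160`). [cite: Tao2016AveragedNS, §5.5] -/
theorem clockInt_ge_of_small' (hc : ∀ t ∈ Icc (0 : ℝ) (8 / 5), |Y t 2| ≤ ε ^ 2) {u : ℝ}
    (hu : u ∈ Icc (0 : ℝ) (8 / 5)) : -(1 / 100) ≤ clockInt ε M Y u := by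
  obtain ⟨hM6000, hε1, hε2, hexpM, hMe, hMe2, hMse, h77, hsM⟩ := ignition_params hK hML hMK hε hεle
  obtain ⟨hδ₀, hδ, hη8, hδ₀1, h732, hs1⟩ := budget_facts' hV hT hK hML hMK hε hεle h0 hη
  have hM0 : 0 < M := by linarith
  have hb0 := (abs_le.1 (abs_init_coord_le h0).1).1
  -- the clock floor β
  obtain ⟨β, hβ⟩ : ∃ β : ℝ, β = δ₀ + 8 / 5 * (M * ε ^ 3 + δ) := ⟨_, rfl⟩
  have hβ0 : 0 ≤ β := by rw [hβ]; positivity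
  have hbfloor : ∀ v ∈ Icc (0 : ℝ) (8 / 5), -β ≤ Y v 1 := by
    intro v hv
    have h := b_sub_ge_of_small hY hV hT hK hML hMK hε hεle hc le_rfl hv.1 hv.2
    have h1 : (M * ε ^ 3 + δ) * (v - 0) ≤ (M * ε ^ 3 + δ) * (8 / 5) :=
      mul_le_mul_of_nonneg_left (by linarith [hv.2]) (by positivity)
    rw [hβ]; linarith
  have hfl : ε⁻¹ * M * β ≤ 1 / 160 := by
    have h1 : ε⁻¹ * M * β = ε⁻¹ * M * (δ₀ + 8 / 5 * δ) + 8 / 5 * (M ^ 2 * ε ^ 2) := by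
      rw [hβ]; field_simp; ring
    have h2 : ε⁻¹ * M * (δ₀ + 8 / 5 * δ) ≤ ε⁻¹ * M * (ε ^ 2 * exp (-M) / 8) :=
      mul_le_mul_of_nonneg_left (by linarith) (by positivity)
    have h3 : ε⁻¹ * M * (ε ^ 2 * exp (-M) / 8) = M * ε * exp (-M) / 8 := by field_simp
    have h4 : M * ε * exp (-M) ≤ 1 / 40 :=
      (mul_le_of_le_one_right (by positivity) (by linarith)).trans hMe
    linarith
  have hmono := Thm53.monotoneOn_sub_of_le_deriv (s := Icc (0 : ℝ) (8 / 5))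
    (f := clockInt ε M Y) (φ := fun _ => -(ε⁻¹ * M * β))
    (Φ := fun v => -(ε⁻¹ * M * β) * v) (convex_Icc 0 _)
    (fun v _ => hasDerivAt_clockIntA hY v)
    (fun v _ => by simpa using (hasDerivAt_id v).const_mul (-(ε⁻¹ * M * β)))
    (fun v hv => by
      have h1 : ε⁻¹ * M * (-β) ≤ ε⁻¹ * M * Y v 1 :=
        mul_le_mul_of_nonneg_left (hbfloor v hv) (by positivity)
      linarith)
  have h := hmono (left_mem_Icc.2 (by norm_num)) hu hu.1
  simp only [clockInt_zero, mul_zero, sub_zero] at h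
  have h5 : ε⁻¹ * M * β * u ≤ 1 / 160 * (8 / 5) := mul_le_mul hfl hu.2 hu.1 (by norm_num)
  linarith

/-- If `|c| ≤ ε²` on the window, the clock is still running on `[1, 8/5]`: `b ≥ (49/50)ε`.
[cite: Tao2016AveragedNS, §5.5 (5.5)] -/
theorem b_ge_late_of_small' (hc : ∀ t ∈ Icc (0 : ℝ) (8 / 5), |Y t 2| ≤ ε ^ 2) {t : ℝ}
    (ht : t ∈ Icc (1 : ℝ) (8 / 5)) : 49 / 50 * ε ≤ Y t 1 := by
  obtain ⟨hM6000, hε1, hε2, hexpM, hMe, hMe2, hMse, h77, hsM⟩ := ignition_params hK hML hMK hε hεle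
  obtain ⟨hδ₀, hδ, hη8, hδ₀1, h732, hs1⟩ := budget_facts' hV hT hK hML hMK hε hεle h0 hη
  have h1 := b_ge_unit' hY hV hR hT hK hML hMK hε hεle h0 hη (t := 1) ⟨zero_le_one, le_rfl⟩
  have h2 := b_sub_ge_of_small hY hV hT hK hML hMK hε hεle hc zero_le_one ht.1 ht.2
  have hε300 : ε ≤ 1 / 300 :=
    le_of_pow_le_pow_left₀ two_ne_zero (by norm_num) (hε2.trans (by norm_num))
  have h3 : M * ε ^ 3 = M * ε * ε ^ 2 := by ring
  have h4 : M * ε * ε ^ 2 ≤ 1 / 40 * ε ^ 2 := mul_le_mul_of_nonneg_right hMe (sq_nonneg ε)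
  have h5 : ε ^ 2 ≤ ε * (1 / 300) := by rw [sq]; exact mul_le_mul_of_nonneg_left hε300 hε.le
  have h6 : ε ^ 2 * exp (-M) ≤ ε ^ 2 := mul_le_of_le_one_right (sq_nonneg ε) (by linarith)
  have h7 : (M * ε ^ 3 + δ) * (t - 1) ≤ (M * ε ^ 3 + δ) * (3 / 5) :=
    mul_le_mul_of_nonneg_left (by linarith [ht.2]) (by positivity)
  linarith

/-- If `|c| ≤ ε²` on the window, the clock integral at the end of the window is large:
`G(8/5) ≥ G(1) + (49/50)(3/5)M ≥ (1083/1000)M - 1/320`. [cite: Tao2016AveragedNS, §5.5] -/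
theorem clockInt_late_of_small' (hc : ∀ t ∈ Icc (0 : ℝ) (8 / 5), |Y t 2| ≤ ε ^ 2) :
    1083 / 1000 * M - 1 / 320 ≤ clockInt ε M Y (8 / 5) := by
  obtain ⟨hM6000, -, -, -, -, -, -, -, -⟩ := ignition_params hK hML hMK hε hεle
  have hG1 := clockInt_ge_unit' hY hV hR hT hK hML hMK hε hεle h0 hη (u := 1) ⟨zero_le_one, le_rfl⟩
  have hmono := Thm53.monotoneOn_sub_of_le_deriv (s := Icc (1 : ℝ) (8 / 5))
    (f := clockInt ε M Y) (φ := fun _ => 49 / 50 * M) (Φ := fun u => 49 / 50 * M * u)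
    (convex_Icc 1 _) (fun u _ => hasDerivAt_clockIntA hY u)
    (fun u _ => by simpa using (hasDerivAt_id u).const_mul (49 / 50 * M))
    (fun u hu => by
      have h1 : ε⁻¹ * M * (49 / 50 * ε) ≤ ε⁻¹ * M * Y u 1 :=
        mul_le_mul_of_nonneg_left (b_ge_late_of_small' hY hV hR hT hK hML hMK hε hεle h0 hη hc hu)
          (by have : (0 : ℝ) ≤ M := by linarith
              positivity)
      have h2 : ε⁻¹ * M * (49 / 50 * ε) = 49 / 50 * M := by field_simp
      linarith)
  have h := hmono (left_mem_Icc.2 (by norm_num)) (right_mem_Icc.2 (by norm_num)) (by norm_num)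
  simp only at h
  linarith

end Eighth

section Seed

variable (hK : 2 * 20 ^ 42 * (Nat.factorial 42 : ℝ) + 16 ≤ K) (hML : 3000 * Real.log K ≤ M)
  (hMK : M ≤ K ^ 10) (hε : 0 < ε) (hεle : ε ≤ exp (-(10 * M)) / K ^ 100)
  (h0 : ‖Y 0 - delayInit‖ ≤ δ₀) (hη : δ₀ + 2 * δ ≤ ε ^ 2 * exp (-M) / (8 * Real.sqrt M))
include hK hML hMK hε hεle h0 hη

/-! ## §3–§4 re-exported under the seed-scale budget `δ₀ + 2δ ≤ ε²e^{-M}/(8√M)` -/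

omit hY hV hR hT h0 in
/-- The seed-scale budget implies the weak one: `ε²e^{-M}/(8√M) ≤ ε²e^{-M}/8` (`√M ≥ 77`).
[cite: Tao2016AveragedNS, §5.5] -/
theorem budget_le_eighth : δ₀ + 2 * δ ≤ ε ^ 2 * exp (-M) / 8 := by
  obtain ⟨-, -, -, -, -, -, -, h77, -⟩ := ignition_params hK hML hMK hε hεle
  have hs0 : 0 ≤ ε ^ 2 * exp (-M) := by positivity
  have h1 : ε ^ 2 * exp (-M) / (8 * Real.sqrt M) ≤ ε ^ 2 * exp (-M) / 8 :=
    div_le_div_of_nonneg_left hs0 (by norm_num) (by linarith)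
  exact hη.trans h1

omit hY hR in
/-- The seed-scale budget in absolute terms: `δ₀ + 2δ ≤ ε²e^{-M}/8 ≤ 10⁻¹¹`, `7δ₀ + 32δ ≤ 2ε²e^{-M}`.
[cite: Tao2016AveragedNS, §5.5] -/
theorem budget_facts :
    0 ≤ δ₀ ∧ 0 ≤ δ ∧ δ₀ + 2 * δ ≤ ε ^ 2 * exp (-M) / 8 ∧ δ₀ ≤ 1 ∧
      7 * δ₀ + 32 * δ ≤ 2 * (ε ^ 2 * exp (-M)) ∧ ε ^ 2 * exp (-M) ≤ 1 / 1000000 :=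
  budget_facts' hV hT hK hML hMK hε hεle h0 (budget_le_eighth hK hML hMK hε hεle hη)

omit hY hR in
/-- **The majorant clock on the window**: `G⁺(t) ≤ Mt²/2 + t²/16000 + t/320` for `t ∈ [0, 8/5]`.
[cite: Tao2016AveragedNS, §5.5] -/
theorem clockSup_le {t : ℝ} (ht : t ∈ Icc (0 : ℝ) (8 / 5)) :
    clockSup M ε δ δ₀ t ≤ M * t ^ 2 / 2 + t ^ 2 / 16000 + t / 320 :=
  clockSup_le' hV hT hK hML hMK hε hεle h0 (budget_le_eighth hK hML hMK hε hεle hη) ht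

/-- **The trigger on the first unit of time**: `|c(t)| ≤ 3ε²e^{-M/2}` for `t ∈ [0,1]`
(budget `≤ ε²e^{-M}/8`, clock `G⁺(1) ≤ M/2 + 1/50`). [cite: Tao2016AveragedNS, §5.5] -/
theorem abs_c_le_unit {t : ℝ} (ht : t ∈ Icc (0 : ℝ) 1) :
    |Y t 2| ≤ 3 * ε ^ 2 * exp (-(M / 2)) :=
  abs_c_le_unit' hY hV hR hT hK hML hMK hε hεle h0 (budget_le_eighth hK hML hMK hε hεle hη) ht

/-- **The clock on the first unit of time**: `-ε ≤ b(t) ≤ 2ε` for `t ∈ [0,1]`.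
[cite: Tao2016AveragedNS, §5.5 (5.5)] -/
theorem b_bounds_unit {t : ℝ} (ht : t ∈ Icc (0 : ℝ) 1) : -ε ≤ Y t 1 ∧ Y t 1 ≤ 2 * ε :=
  b_bounds_unit' hY hV hR hT hK hML hMK hε hεle h0 (budget_le_eighth hK hML hMK hε hεle hη) ht

/-- **The outputs on the first unit of time**: `|d(t)|, |ã(t)| ≤ 7e^{-M/2}` for `t ∈ [0,1]`
(the rotor drive is `ε⁻²|c||a| ≤ 6e^{-M/2}`, plus the defect). [cite: Tao2016AveragedNS, §5.5 (5.5)] -/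
theorem de_le_unit {t : ℝ} (ht : t ∈ Icc (0 : ℝ) 1) :
    |Y t 3| ≤ 7 * exp (-(M / 2)) ∧ |Y t 4| ≤ 7 * exp (-(M / 2)) :=
  de_le_unit' hY hV hR hT hK hML hMK hε hεle h0 (budget_le_eighth hK hML hMK hε hεle hη) ht

/-- **The carrier on the first unit of time**: `a(t)² ≥ 999/1000` for `t ∈ [0,1]`
(energy `≥ 1 - 2ε²e^{-M}`, and `b², c², d², ã²` are `≤ 4ε², 9ε⁴e^{-M}, 49e^{-M}, 49e^{-M}`).
[cite: Tao2016AveragedNS, §5.5 (energy-con)] -/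
theorem a_sq_ge_unit {t : ℝ} (ht : t ∈ Icc (0 : ℝ) 1) : 999 / 1000 ≤ Y t 0 ^ 2 :=
  a_sq_ge_unit' hY hV hR hT hK hML hMK hε hεle h0 (budget_le_eighth hK hML hMK hε hεle hη) ht

/-- **The clock on the first unit of time, from below**: `b(t) ≥ -δ₀ + (99/100)εt` on `[0,1]`
(`ḃ ≥ (999/1000)ε - 9Mε³e^{-M} - δ`). [cite: Tao2016AveragedNS, §5.5 (5.5)] -/
theorem b_ge_unit {t : ℝ} (ht : t ∈ Icc (0 : ℝ) 1) : -δ₀ + 99 / 100 * ε * t ≤ Y t 1 :=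
  b_ge_unit' hY hV hR hT hK hML hMK hε hεle h0 (budget_le_eighth hK hML hMK hε hεle hη) ht

/-- **The clock integral on the first unit of time, from below**:
`G(u) ≥ (99/200)Mu² - ε⁻¹Mδ₀u ≥ (99/200)Mu² - 1/320` on `[0,1]`. [cite: Tao2016AveragedNS, §5.5] -/
theorem clockInt_ge_unit {u : ℝ} (hu : u ∈ Icc (0 : ℝ) 1) :
    99 / 200 * M * u ^ 2 - 1 / 320 ≤ clockInt ε M Y u :=
  clockInt_ge_unit' hY hV hR hT hK hML hMK hε hεle h0 (budget_le_eighth hK hML hMK hε hεle hη) hu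

omit hR in
/-- **Persistence of the discounted trigger**: if `G ≥ -1/100` on `[0,τ]`, `τ ≤ 8/5`, then
`D(t) ≥ D(r) - (102/100)δ(t - r)` for `0 ≤ r ≤ t ≤ τ` (`D' ≥ -δe^{-G}`). [cite: Tao2016AveragedNS, §5.5] -/
theorem disc_persist {τ : ℝ} (hτ : τ ≤ 8 / 5)
    (hG : ∀ u ∈ Icc (0 : ℝ) τ, -(1 / 100) ≤ clockInt ε M Y u) {r t : ℝ} (hr : 0 ≤ r)
    (hrt : r ≤ t) (ht : t ≤ τ) :
    Y r 2 * exp (-clockInt ε M Y r) - 102 / 100 * δ * (t - r) ≤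
      Y t 2 * exp (-clockInt ε M Y t) :=
  disc_persist' hY hV hT hK hML hMK hε hεle h0 (budget_le_eighth hK hML hMK hε hεle hη) hτ hG hr hrt ht

omit hR in
/-- If `|c| ≤ ε²` on the window, the clock integral stays `≥ -1/100` there
(`b ≥ -δ₀ - (8/5)(Mε³ + δ)`, and `ε⁻¹M` times that is `≤ 1/160`). [cite: Tao2016AveragedNS, §5.5] -/
theorem clockInt_ge_of_small (hc : ∀ t ∈ Icc (0 : ℝ) (8 / 5), |Y t 2| ≤ ε ^ 2) {u : ℝ}
    (hu : u ∈ Icc (0 : ℝ) (8 / 5)) : -(1 / 100) ≤ clockInt ε M Y u :=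
  clockInt_ge_of_small' hY hV hT hK hML hMK hε hεle h0 (budget_le_eighth hK hML hMK hε hεle hη) hc hu

/-- If `|c| ≤ ε²` on the window, the clock is still running on `[1, 8/5]`: `b ≥ (49/50)ε`.
[cite: Tao2016AveragedNS, §5.5 (5.5)] -/
theorem b_ge_late_of_small (hc : ∀ t ∈ Icc (0 : ℝ) (8 / 5), |Y t 2| ≤ ε ^ 2) {t : ℝ}
    (ht : t ∈ Icc (1 : ℝ) (8 / 5)) : 49 / 50 * ε ≤ Y t 1 :=
  b_ge_late_of_small' hY hV hR hT hK hML hMK hε hεle h0 (budget_le_eighth hK hML hMK hε hεle hη) hc ht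

/-- If `|c| ≤ ε²` on the window, the clock integral at the end of the window is large:
`G(8/5) ≥ G(1) + (49/50)(3/5)M ≥ (1083/1000)M - 1/320`. [cite: Tao2016AveragedNS, §5.5] -/
theorem clockInt_late_of_small (hc : ∀ t ∈ Icc (0 : ℝ) (8 / 5), |Y t 2| ≤ ε ^ 2) :
    1083 / 1000 * M - 1 / 320 ≤ clockInt ε M Y (8 / 5) :=
  clockInt_late_of_small' hY hV hR hT hK hML hMK hε hεle h0 (budget_le_eighth hK hML hMK hε hεle hη) hc

/-- **The Gaussian-window deposit**: at `u₀ = 1/√M` the discounted trigger is at least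
`-δ₀ + (9/20)·ε²e^{-M}/√M` (on `[0, 1/√M]` the clock satisfies `G ≤ G⁺(1/√M) ≤ 51/100`, so the seed
deposits at rate `≥ (49/100)(999/1000·ε²e^{-M} - δ)`). [cite: Tao2016AveragedNS, §5.5] -/
theorem disc_window :
    -δ₀ + 9 / 20 * (ε ^ 2 * exp (-M)) / Real.sqrt M ≤
      Y (Real.sqrt M)⁻¹ 2 * exp (-clockInt ε M Y (Real.sqrt M)⁻¹) := by
  obtain ⟨hM6000, hε1, -, hexpM, hMe, -, hMse, h77, hsM⟩ := ignition_params hK hML hMK hε hεle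
  obtain ⟨hδ₀, hδ, hη8, hδ₀1, h732, hs1⟩ := budget_facts hV hT hK hML hMK hε hεle h0 hη
  have hM : 0 ≤ M := by linarith
  have hsq0 : 0 < Real.sqrt M := by linarith
  set u₀ : ℝ := (Real.sqrt M)⁻¹ with hu₀
  have hu₀0 : 0 < u₀ := by positivity
  have hu₀1 : u₀ ≤ 1 := by rw [hu₀]; exact inv_le_one_of_one_le₀ (by linarith)
  have hu₀sq : M * u₀ ^ 2 = 1 := by
    rw [hu₀, inv_pow, Real.sq_sqrt hM]; field_simp
  set s : ℝ := ε ^ 2 * exp (-M) with hs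
  have hs0 : 0 < s := by positivity
  -- the clock on the window: G(u) ≤ G⁺(u₀) ≤ 51/100
  have hGsup : clockSup M ε δ δ₀ u₀ ≤ 51 / 100 := by
    have := clockSup_le hV hT hK hML hMK hε hεle h0 hη (t := u₀) ⟨hu₀0.le, by linarith⟩
    nlinarith
  set m : ℝ := 49 / 100 * (999 / 1000 * s - δ) with hm
  have hm0 : 0 ≤ 999 / 1000 * s - δ := by nlinarith
  have hmono := Thm53.monotoneOn_sub_of_le_deriv (s := Icc (0 : ℝ) u₀)
    (f := fun r => Y r 2 * exp (-clockInt ε M Y r)) (φ := fun _ => m) (Φ := fun u => m * u)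
    (convex_Icc 0 u₀) (fun u _ => hasDerivAt_discA hY u)
    (fun u _ => by simpa using (hasDerivAt_id u).const_mul m)
    (fun u hu => by
      have hu1 : u ∈ Icc (0 : ℝ) 1 := ⟨hu.1, hu.2.trans hu₀1⟩
      have hu' : u ∈ Icc (0 : ℝ) (8 / 5) := ⟨hu.1, by linarith [hu.2]⟩
      have h1 := disc_deriv_geA hV hT hu' (K := K)
      have ha := a_sq_ge_unit hY hV hR hT hK hML hMK hε hεle h0 hη hu1
      have hGu : clockInt ε M Y u ≤ 51 / 100 := by
        have h2 := clockInt_le_clockSup hY hV hR hT h0 hδ₀1 hε hM hu'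
        have h3 := clockSup_mono hM hε hδ hδ₀ hu.1 hu.2 (M := M)
        linarith
      have hexp : 49 / 100 ≤ exp (-clockInt ε M Y u) := by
        have := add_one_le_exp (-clockInt ε M Y u)
        linarith
      have h4 : 999 / 1000 * s - δ ≤ ε ^ 2 * exp (-M) * Y u 0 ^ 2 - δ := by
        rw [hs]; nlinarith [mul_pos (pow_pos hε 2) (exp_pos (-M))]
      calc m = (999 / 1000 * s - δ) * (49 / 100) := by rw [hm]; ring
        _ ≤ (ε ^ 2 * exp (-M) * Y u 0 ^ 2 - δ) * exp (-clockInt ε M Y u) :=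
            mul_le_mul h4 hexp (by norm_num) (by linarith)
        _ ≤ _ := h1)
  have h := hmono (left_mem_Icc.2 hu₀0.le) (right_mem_Icc.2 hu₀0.le) hu₀0.le
  simp only [clockInt_zero, neg_zero, exp_zero, mul_one, mul_zero, sub_zero] at h
  have hc0 := (abs_le.1 (abs_init_coord_le h0).2.1).1
  have hm1 : 9 / 20 * s ≤ m := by rw [hm]; nlinarith
  have h5 : 9 / 20 * s / Real.sqrt M ≤ m * u₀ := by
    rw [hu₀, div_eq_mul_inv]
    exact mul_le_mul_of_nonneg_right hm1 (by positivity)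
  linarith

/-- If `|c| ≤ ε²` on the window, the discounted trigger keeps (most of) its window deposit:
`D(t) ≥ (13/40)·ε²e^{-M}/√M` for `t ∈ [1/√M, 8/5]`. [cite: Tao2016AveragedNS, §5.5] -/
theorem disc_ge_of_small (hc : ∀ t ∈ Icc (0 : ℝ) (8 / 5), |Y t 2| ≤ ε ^ 2) {t : ℝ}
    (ht : t ∈ Icc (Real.sqrt M)⁻¹ (8 / 5)) :
    13 / 40 * (ε ^ 2 * exp (-M)) / Real.sqrt M ≤ Y t 2 * exp (-clockInt ε M Y t) := by
  obtain ⟨hM6000, hε1, hε2, hexpM, hMe, hMe2, hMse, h77, hsM⟩ := ignition_params hK hML hMK hε hεle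
  obtain ⟨hδ₀, hδ, hη8, hδ₀1, h732, hs1⟩ := budget_facts hV hT hK hML hMK hε hεle h0 hη
  have hsq0 : 0 < Real.sqrt M := by linarith
  have hu₀0 : 0 < (Real.sqrt M)⁻¹ := by positivity
  have hwin := disc_window hY hV hR hT hK hML hMK hε hεle h0 hη
  have hp := disc_persist hY hV hT hK hML hMK hε hεle h0 hη (τ := 8 / 5) le_rfl
    (fun u hu => clockInt_ge_of_small hY hV hT hK hML hMK hε hεle h0 hη hc hu) hu₀0.le ht.1 ht.2
  have h1 : 102 / 100 * δ * (t - (Real.sqrt M)⁻¹) ≤ 102 / 100 * δ * (8 / 5) :=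
    mul_le_mul_of_nonneg_left (by linarith [ht.2]) (by positivity)
  have h2 : δ₀ + 2 * δ ≤ ε ^ 2 * exp (-M) / 8 / Real.sqrt M := by
    rw [div_div]; simpa [mul_comm] using hη
  have h3 : 13 / 40 * (ε ^ 2 * exp (-M)) / Real.sqrt M =
      9 / 20 * (ε ^ 2 * exp (-M)) / Real.sqrt M - ε ^ 2 * exp (-M) / 8 / Real.sqrt M := by ring
  rw [h3]
  linarith

/-- **Seed-scale ignition (section form).** Under the standing hypotheses, along an approximate
trajectory issued `δ₀`-close to (5.6) with `δ₀ + 2δ ≤ ε²e^{-M}/(8√M)`, the trigger exceeds the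
ignition magnitude: `|c(t)| > ε²` for some `t ∈ [0, 8/5]` (else `c(8/5) = D(8/5)e^{G(8/5)} ≥ 2ε²`).
[cite: Tao2016AveragedNS, §5.5 Theorem 5.3] -/
theorem exists_abs_c_gt_sq : ∃ t ∈ Icc (0 : ℝ) (8 / 5), ε ^ 2 < |Y t 2| := by
  obtain ⟨hM6000, hε1, hε2, hexpM, hMe, hMe2, hMse, h77, hsM⟩ := ignition_params hK hML hMK hε hεle
  have hM : 0 ≤ M := by linarith
  by_contra hcon
  simp only [not_exists, not_and, not_lt] at hcon
  have hc : ∀ t ∈ Icc (0 : ℝ) (8 / 5), |Y t 2| ≤ ε ^ 2 := fun t ht => hcon t ht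
  have hsq0 : 0 < Real.sqrt M := by linarith
  have hu₀85 : (Real.sqrt M)⁻¹ ≤ 8 / 5 := (inv_le_one_of_one_le₀ (by linarith)).trans (by norm_num)
  have hD := disc_ge_of_small hY hV hR hT hK hML hMK hε hεle h0 hη hc (t := 8 / 5) ⟨hu₀85, le_rfl⟩
  have hG := clockInt_late_of_small hY hV hR hT hK hML hMK hε hεle h0 hη hc
  -- e^{G(8/5) - M} ≥ (82/1000)·M
  have hEG : 82 / 1000 * M ≤ exp (clockInt ε M Y (8 / 5) - M) := by
    have := add_one_le_exp (clockInt ε M Y (8 / 5) - M)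
    linarith
  -- c(8/5) ≥ (13/40)(ε²e^{-M}/√M)·e^{G(8/5)} = (13/40)(ε²/√M)·e^{G(8/5)-M} ≥ 2ε²
  have hc85 : 13 / 40 * (ε ^ 2 * exp (-M)) / Real.sqrt M * exp (clockInt ε M Y (8 / 5)) ≤
      Y (8 / 5) 2 := by
    have h1 : Y (8 / 5) 2 = (Y (8 / 5) 2 * exp (-clockInt ε M Y (8 / 5))) *
        exp (clockInt ε M Y (8 / 5)) := by rw [mul_assoc, ← exp_add]; simp
    rw [h1]
    exact mul_le_mul_of_nonneg_right hD (exp_pos _).le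
  have hkey : 2 * ε ^ 2 ≤
      13 / 40 * (ε ^ 2 * exp (-M)) / Real.sqrt M * exp (clockInt ε M Y (8 / 5)) := by
    have h1 : 13 / 40 * (ε ^ 2 * exp (-M)) / Real.sqrt M * exp (clockInt ε M Y (8 / 5)) =
        13 / 40 * ε ^ 2 / Real.sqrt M * exp (clockInt ε M Y (8 / 5) - M) := by
      rw [exp_sub, exp_neg]; field_simp
    rw [h1]
    have h2 : 13 / 40 * ε ^ 2 / Real.sqrt M * (82 / 1000 * M) ≤
        13 / 40 * ε ^ 2 / Real.sqrt M * exp (clockInt ε M Y (8 / 5) - M) :=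
      mul_le_mul_of_nonneg_left hEG (by positivity)
    have h3 : 13 / 40 * ε ^ 2 / Real.sqrt M * (82 / 1000 * M) =
        13 / 40 * (82 / 1000) * ε ^ 2 * (M / Real.sqrt M) := by ring
    rw [Real.div_sqrt] at h3
    have h4 : 13 / 40 * (82 / 1000) * ε ^ 2 * 77 ≤ 13 / 40 * (82 / 1000) * ε ^ 2 * Real.sqrt M :=
      mul_le_mul_of_nonneg_left h77 (by positivity)
    nlinarith [pow_pos hε 2]
  have hlast := hc (8 / 5) ⟨by norm_num, le_rfl⟩
  have habs : Y (8 / 5) 2 ≤ |Y (8 / 5) 2| := le_abs_self _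
  nlinarith [pow_pos hε 2]

end Seed

end Approx

end Ignition

/-! ## §5. Exported statements -/

/-- **Seed-scale ignition is forced (Tao 2016 §5.5, approximate trajectories).** For every member
of the retuned family under the standing hypotheses of its Theorem 5.3, every differentiable
approximate trajectory `Y` (velocity `V`, `‖V - F(Y)‖ ≤ δ` and `‖Y‖ ≤ 2` on `[0,T)`, `T ≥ 2`) issued
`δ₀`-close to the datum (5.6) with TOTAL budget `δ₀ + δT ≤ ε²e^{-M}/(8√M)` carries its trigger to the
ignition magnitude `|c| = ε²` by time `8/5`. Compare `exists_negativeKick_dud_sharp`: a datum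
perturbation of size `< 2ε²e^{-M}/√M` (no forcing) keeps `|c| ≤ 3ε²e^{-M} < ε²` on the whole cycle
`[0,2]`. This is NOT a firing theorem: reaching `|c| = ε²` starts the rotor, and the transition phase
with defect is not analysed here. [cite: Tao2016AveragedNS, §5.5 Theorem 5.3] -/
theorem ignition_forced (K M ε δ δ₀ T : ℝ) (Y V : ℝ → Fin 5 → ℝ)
    (hK : 2 * 20 ^ 42 * (Nat.factorial 42 : ℝ) + 16 ≤ K) (hML : 3000 * Real.log K ≤ M)
    (hMK : M ≤ K ^ 10) (hε : 0 < ε) (hεle : ε ≤ exp (-(10 * M)) / K ^ 100) (hT : 2 ≤ T)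
    (hY : ∀ t, HasDerivAt Y (V t) t)
    (hV : ∀ t ∈ Ico 0 T, ‖V t - delayCircuitWith K M ε (Y t)‖ ≤ δ)
    (hR : ∀ t ∈ Ico 0 T, ‖Y t‖ ≤ 2) (h0 : ‖Y 0 - delayInit‖ ≤ δ₀)
    (hB : δ₀ + δ * T ≤ ε ^ 2 * exp (-M) / (8 * Real.sqrt M)) :
    ∃ t ∈ Icc (0 : ℝ) (8 / 5), ε ^ 2 < |Y t 2| := by
  have hδ : 0 ≤ δ := Ignition.defect_nonneg hV hT
  have hη : δ₀ + 2 * δ ≤ ε ^ 2 * exp (-M) / (8 * Real.sqrt M) := by nlinarith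
  exact Ignition.exists_abs_c_gt_sq hY hV hR hT hK hML hMK hε hεle h0 hη

/-- **The stall threshold of the gate is the discounted seed `Θ(ε²e^{-M}/√M)` (two-sided).**
(i) Some exact trajectory of the member from an energy-one datum within `2ε²e^{-M}/√M` of (5.6)
keeps `|c| < ε²` on the whole cycle `[0,2]` (the negative-kick dud); (ii) no approximate trajectory
with total budget `δ₀ + δT ≤ ε²e^{-M}/(8√M)` keeps `|c| < ε²` on `[0, 8/5]`.
[cite: Tao2016AveragedNS, §5.5 Theorem 5.3] -/
theorem stall_threshold_two_sided (K M ε : ℝ)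
    (hK : 2 * 20 ^ 42 * (Nat.factorial 42 : ℝ) + 16 ≤ K) (hML : 3000 * Real.log K ≤ M)
    (hMK : M ≤ K ^ 10) (hε : 0 < ε) (hεle : ε ≤ exp (-(10 * M)) / K ^ 100) :
    (∃ κ : ℝ, 0 < κ ∧ κ < 2 * (ε ^ 2 * exp (-M)) / Real.sqrt M ∧
      ‖kickInit (-κ) - delayInit‖ ≤ κ ∧
      ∀ t ∈ Icc (0 : ℝ) 2, |delayFlowWith K M ε t (kickInit (-κ)) 2| < ε ^ 2) ∧
    (∀ (δ δ₀ T : ℝ) (Y V : ℝ → Fin 5 → ℝ), 2 ≤ T → (∀ t, HasDerivAt Y (V t) t) →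
      (∀ t ∈ Ico 0 T, ‖V t - delayCircuitWith K M ε (Y t)‖ ≤ δ) → (∀ t ∈ Ico 0 T, ‖Y t‖ ≤ 2) →
      ‖Y 0 - delayInit‖ ≤ δ₀ → δ₀ + δ * T ≤ ε ^ 2 * exp (-M) / (8 * Real.sqrt M) →
      ∃ t ∈ Icc (0 : ℝ) (8 / 5), ε ^ 2 < |Y t 2|) := by
  refine ⟨?_, fun δ δ₀ T Y V hT hY hV hR h0 hB =>
    ignition_forced K M ε δ δ₀ T Y V hK hML hMK hε hεle hT hY hV hR h0 hB⟩
  obtain ⟨κ, hκ0, hκ2, -, hc⟩ := exists_negativeKick_dud_sharp hK hML hMK hε hεle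
  obtain ⟨hM6000, hε1, hε2, hexpM, -, -, -, h77, -⟩ := Ignition.ignition_params hK hML hMK hε hεle
  have hs3 : 3 * (ε ^ 2 * exp (-M)) < ε ^ 2 := by nlinarith [pow_pos hε 2]
  have hκ1 : κ ≤ 1 := by
    have h1 : 2 * (ε ^ 2 * exp (-M)) / Real.sqrt M ≤ 2 * (ε ^ 2 * exp (-M)) :=
      div_le_self (by positivity) (by linarith)
    nlinarith [pow_pos hε 2, exp_pos (-M)]
  refine ⟨κ, hκ0, hκ2, norm_kickInit_neg_sub_delayInit hκ0.le hκ1, fun t ht => ?_⟩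
  obtain ⟨hle, hge, -, -⟩ := hc t ht
  rw [abs_lt]; constructor <;> linarith

end Literature.Analysis.FluidPDE.Tao2016AveragedNS
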